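import Literature.Probability.Percolation.IntPairCut
import HarnessLib

/-!
# The asymmetric inner pair step (one arm on the tip arc, the other arbitrary): no cut on the free arm (twin of `TrapPairAsym.lean`)

Topic `Literature/Probability/Percolation`; family `crit-perc` / near-critical percolation on `𝕋`.
A brick of the INNER half of the near-critical arm-separation theorem for four arms in the ADJACENT
colour arrangement (P. Nolin, EJP 13 (2008), Thm. 11, `j = 4`, `σ = BBWW` [arXiv 0711.4948:
Thm. 10], §4.4 Lemma 15, internal extremities). Two arms of the same colour landing on DIFFERENT
inner sides: the no-cut argument behind Menger's theorem is run, for a cut site on one arm, in the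
half-annulus domain of the OTHER arm. Word-for-word twin of `TrapPairAsym.lean` in the inner
setting (`IntPairDataA`: the arm `0` ends on the inner tip arc, the arm `1` on the tip arc as well
or with `(y 1)₀ + 3k < m` for all scales), concluding with `IntPairDataA.not_isCut_of_mem_arm1`.

Everything here is proved; no named facts are introduced.

## References

* P. Nolin, Near-critical percolation in two dimensions, *Electron. J. Probab.* 13 (2008), §4.4,
  proof of Lemma 15, internal extremities (arXiv 0711.4948: Lemma 14), last paragraph [Nolin2008].
* H. Kesten, *Percolation theory for mathematicians* (1982), §2.3 [KestenPTM1982].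
* R. Diestel, *Graph Theory*, 5th ed. (2017), Thm. 3.3.1 (Menger) [Diestel2017].
-/

noncomputable section

open Set

namespace Literature.Probability.Percolation

open LatticeModels HalfAnnulus Literature.Combinatorics.SimpleGraph

/-! ### The data -/

/-- **The setting of the asymmetric inner pair step** (side `0`, open colour): two disjoint clean
open self-avoiding arms of `{m ≤ |v| ≤ N}` from far ends beyond `Λ_{2m}`, the arm `0` ending on the
inner tip arc, the arm `1` ending on the tip arc as well OR at a site `y 1` with
`(y 1)₀ + 3k < m` for all the scales `k` (the middle of another inner side), on the raw good event
of the exploration of `intDom m` in `ω`, every term having a middle tip at margin `R₀`. [cite: Nolin2008, §4.4 Lemma 15 (proof), internal extremities (arXiv 0711.4948: Lemma 14)] -/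
structure IntPairDataA (m N k₀ K T R₀ : ℕ) (ω : SiteConfig (Site 2)) where
  /-- the far ends -/
  b : Fin 2 → Site 2
  /-- the ends -/
  y : Fin 2 → Site 2
  /-- the arms -/
  A : (i : Fin 2) → triGraph.Walk (b i) (y i)
  isPath : ∀ i, (A i).IsPath
  supp : ∀ i, ∀ v ∈ (A i).support, ((m : ℤ) ≤ triNorm v ∧ triNorm v ≤ N) ∧ v ∈ ω
  b_far : ∀ i, 2 * (m : ℤ) < triNorm (b i)
  /-- the arm `0` ends on the inner tip arc -/
  y_isIntJ : IsIntJ m (y 0)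
  /-- the arm `1` ends on the tip arc too (same frame) or far from every fence zone (cross frame) -/
  yfar : IsIntJ m (y 1) ∨ ∀ j < K, (y 1) 0 + 3 * (trapScale k₀ j : ℤ) < m
  clean : ∀ i, ∀ v ∈ (A i).support, triNorm v = m → v = y i
  disj : ∀ v ∈ (A 0).support, v ∉ (A 1).support
  stop : (intDom m).lowestSeq ω T = none
  good : ∀ u < T, ¬ IntSeqFailRaw m u k₀ K ω
  mid : ∀ u c z, (intDom m).lowestSeq ω u = some (c, z) → IntMidTip m R₀ z
  hm : 5 ≤ m
  hN : 4 * m ≤ N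
  hk₀ : 2 ≤ k₀
  hKm : ∀ j < K, 4 * (16 * trapScale k₀ j) < m
  hKR : ∀ j < K, 32 * trapScale k₀ j + 1 ≤ R₀
  hR₀ : 4 * R₀ < m

namespace IntPairDataA

variable {m N k₀ K T R₀ : ℕ} {ω : SiteConfig (Site 2)}

/-! ### The arms -/

/-- The sites of the two arms. [folklore] -/
def armSet (D : IntPairDataA m N k₀ K T R₀ ω) : Set (Site 2) := {v | ∃ i, v ∈ (D.A i).support}

/-- The stopping set of the fence of a term: the term and the arms. [folklore] -/
def S (D : IntPairDataA m N k₀ K T R₀ ω) (c : Finset (Site 2)) : Set (Site 2) := (↑c : Set (Site 2)) ∪ D.armSet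

/-- Bookkeeping (`mem_armSet`). [folklore] -/
theorem mem_armSet (D : IntPairDataA m N k₀ K T R₀ ω) {v : Site 2} {i : Fin 2} (hv : v ∈ (D.A i).support) : v ∈ D.armSet := ⟨i, hv⟩

/-- Bookkeeping (`norm_ge`). [folklore] -/
theorem norm_ge (D : IntPairDataA m N k₀ K T R₀ ω) {i : Fin 2} {v : Site 2} (hv : v ∈ (D.A i).support) : (m : ℤ) ≤ triNorm v :=
  (D.supp i v hv).1.1

/-- Bookkeeping (`norm_le`). [folklore] -/
theorem norm_le (D : IntPairDataA m N k₀ K T R₀ ω) {i : Fin 2} {v : Site 2} (hv : v ∈ (D.A i).support) : triNorm v ≤ N :=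
  (D.supp i v hv).1.2

/-- Bookkeeping (`mem_omega`). [folklore] -/
theorem mem_omega (D : IntPairDataA m N k₀ K T R₀ ω) {i : Fin 2} {v : Site 2} (hv : v ∈ (D.A i).support) : v ∈ ω := (D.supp i v hv).2

/-- Bookkeeping (`armSet_norm_ge`). [folklore] -/
theorem armSet_norm_ge (D : IntPairDataA m N k₀ K T R₀ ω) {v : Site 2} (hv : v ∈ D.armSet) : (m : ℤ) ≤ triNorm v := by
  obtain ⟨i, hv⟩ := hv; exact D.norm_ge hv

/-- Bookkeeping (`armSet_subset`). [folklore] -/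
theorem armSet_subset (D : IntPairDataA m N k₀ K T R₀ ω) : D.armSet ⊆ ω := fun _ ⟨_, hv⟩ => D.mem_omega hv

/-- The end of the arm `0` has norm `m` and lies in the half-annulus and on the tip arc. [folklore] -/
theorem y_mem_J (D : IntPairDataA m N k₀ K T R₀ ω) : D.y 0 ∈ (intDom m).J := by
  obtain ⟨h0, h1, h2⟩ := D.y_isIntJ
  have hn : triNorm (D.y 0) = m := by rw [triNorm_eq_max]; omega
  exact mem_intDom_J.2 ⟨mem_haFin.2 ⟨by omega, by omega, by omega⟩, ⟨h0, h1, h2⟩⟩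

/-- An end on the tip arc is a site of `(intDom m).J`. [folklore] -/
theorem mem_J_of_isIntJ {y : Site 2} (hy : IsIntJ m y) : y ∈ (intDom m).J := by
  obtain ⟨h0, h1, h2⟩ := hy
  have hn : triNorm y = m := by rw [triNorm_eq_max]; omega
  exact mem_intDom_J.2 ⟨mem_haFin.2 ⟨by omega, by omega, by omega⟩, ⟨h0, h1, h2⟩⟩

/-- The two arms are disjoint, symmetric form. [folklore] -/
theorem disj' (D : IntPairDataA m N k₀ K T R₀ ω) {i j : Fin 2} (hij : i ≠ j) {v : Site 2} (hv : v ∈ (D.A i).support) : v ∉ (D.A j).support := by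
  fin_cases i <;> fin_cases j
  · exact absurd rfl hij
  · exact D.disj v hv
  · exact fun h => D.disj v h hv
  · exact absurd rfl hij

/-! ### The terms -/

/-- Bookkeeping (`hcut`). [folklore] -/
theorem hcut (D : IntPairDataA m N k₀ K T R₀ ω) : (intDom m).CutProp := intDom_cutProp D.hm

/-- Bookkeeping (`hdual`). [folklore] -/
theorem hdual (D : IntPairDataA m N k₀ K T R₀ ω) : (intDom m).DualProp := intDom_dualProp D.hm

/-- The tip of a term is a middle tip at every scale of the sequence. [folklore] -/
theorem tip_mid (D : IntPairDataA m N k₀ K T R₀ ω) {u : ℕ} {c : Finset (Site 2)} {z : Site 2} (hu : (intDom m).lowestSeq ω u = some (c, z))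
    {j : ℕ} (hj : j < K) : -(m : ℤ) + 32 * trapScale k₀ j + 1 ≤ z 1 ∧ z 1 ≤ -(32 * (trapScale k₀ j : ℤ) + 1) := by
  have h1 := D.mid u c z hu
  have h2 := D.hKR j hj
  unfold IntMidTip at h1
  have h3 : (32 * trapScale k₀ j + 1 : ℕ) ≤ (R₀ : ℤ) := by exact_mod_cast h2
  push_cast at h3
  omega

/-- A term exists only below the stopping index. [folklore] -/
theorem lt_of_some (D : IntPairDataA m N k₀ K T R₀ ω) {u : ℕ} {c : Finset (Site 2)} {z : Site 2} (hu : (intDom m).lowestSeq ω u = some (c, z)) : u < T := by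
  by_contra h
  rw [JDomain.lowestSeq_eq_none_of_le D.stop (not_lt.1 h)] at hu
  exact absurd hu (by simp)

open IntPairData (term_isCrossing term_open term_norm tip_isIntJ' term_eq)
open PairData (fin2_eq_of_ne)

/-- A later term lies above an earlier one. [cite: KestenPTM1982, §2.3 Prop. 2.3] -/
theorem term_above_of_lt (D : IntPairDataA m N k₀ K T R₀ ω) {u v : ℕ} (huv : u < v) {c c' : Finset (Site 2)} {z z' : Site 2}
    (hu : (intDom m).lowestSeq ω u = some (c, z)) (hv : (intDom m).lowestSeq ω v = some (c', z')) :
    c' ⊆ (intDom m).above c z := JDomain.lowestSeq_subset_above_of_lt D.hcut huv hu hv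

/-- A later term lies off `lower` of an earlier one. [cite: KestenPTM1982, §2.3 Prop. 2.3] -/
theorem term_offLower_of_lt (D : IntPairDataA m N k₀ K T R₀ ω) {u v : ℕ} (huv : u < v) {c c' : Finset (Site 2)} {z z' : Site 2}
    (hu : (intDom m).lowestSeq ω u = some (c, z)) (hv : (intDom m).lowestSeq ω v = some (c', z')) :
    ∀ x ∈ c', x ∉ (intDom m).lower c z := fun _ hx hxl =>
  (JDomain.mem_lower_iff_not_mem_above ((term_isCrossing hv).subset hx)).1 hxl (D.term_above_of_lt huv hu hv hx)

/-- Distinct terms are disjoint. [cite: KestenPTM1982, §2.3 Prop. 2.3] -/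
theorem term_disjoint_of_lt (D : IntPairDataA m N k₀ K T R₀ ω) {u v : ℕ} (huv : u < v) {c c' : Finset (Site 2)} {z z' : Site 2}
    (hu : (intDom m).lowestSeq ω u = some (c, z)) (hv : (intDom m).lowestSeq ω v = some (c', z')) :
    Disjoint c c' := JDomain.lowestSeq_disjoint_of_lt D.hcut huv hu hv

/-- An earlier term lies below a later one. [cite: KestenPTM1982, §2.3 Prop. 2.3] -/
theorem term_below_of_lt (D : IntPairDataA m N k₀ K T R₀ ω) {u v : ℕ} (huv : u < v) {c c' : Finset (Site 2)} {z z' : Site 2}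
    (hu : (intDom m).lowestSeq ω u = some (c, z)) (hv : (intDom m).lowestSeq ω v = some (c', z')) :
    c ⊆ (intDom m).below c' z' := by
  intro x hx
  have hl : x ∈ (intDom m).lower c' z' :=
    JDomain.lower_subset_lower_of_le D.hcut huv.le hu hv (JDomain.mem_lower.2 (Or.inl hx))
  rcases JDomain.mem_lower.1 hl with h | h
  · exact absurd h (Finset.disjoint_left.1 (D.term_disjoint_of_lt huv hu hv) hx)
  · exact h

/-- The tips increase. [cite: KestenPTM1982, §2.3 Prop. 2.3] -/
theorem tip_lt_of_lt (D : IntPairDataA m N k₀ K T R₀ ω) {u v : ℕ} (huv : u < v) {c c' : Finset (Site 2)} {z z' : Site 2}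
    (hu : (intDom m).lowestSeq ω u = some (c, z)) (hv : (intDom m).lowestSeq ω v = some (c', z')) : z 1 < z' 1 := by
  have := JDomain.ht_lowestSeq_lt_of_lt D.hcut huv hu hv
  simpa using this

/-! ### The scale and the fence of a term -/

/-- The index of a raw-good scale of the term. [folklore] -/
def jOf (D : IntPairDataA m N k₀ K T R₀ ω) {u : ℕ} {c : Finset (Site 2)} {z : Site 2} (hu : (intDom m).lowestSeq ω u = some (c, z)) : ℕ :=
  Classical.choose (exists_intRawOK_of_not_failRaw (D.good u (D.lt_of_some hu)) hu)

/-- Bookkeeping (`jOf_spec`). [folklore] -/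
theorem jOf_spec (D : IntPairDataA m N k₀ K T R₀ ω) {u : ℕ} {c : Finset (Site 2)} {z : Site 2} (hu : (intDom m).lowestSeq ω u = some (c, z)) :
    D.jOf hu < K ∧ IntRawOK m c z (trapScale k₀ (D.jOf hu)) ω :=
  Classical.choose_spec (exists_intRawOK_of_not_failRaw (D.good u (D.lt_of_some hu)) hu)

/-- The raw-good scale of the term. [folklore] -/
def kOf (D : IntPairDataA m N k₀ K T R₀ ω) {u : ℕ} {c : Finset (Site 2)} {z : Site 2} (hu : (intDom m).lowestSeq ω u = some (c, z)) : ℕ :=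
  trapScale k₀ (D.jOf hu)

/-- Bookkeeping (`raw`). [folklore] -/
theorem raw (D : IntPairDataA m N k₀ K T R₀ ω) {u : ℕ} {c : Finset (Site 2)} {z : Site 2} (hu : (intDom m).lowestSeq ω u = some (c, z)) :
    IntRawOK m c z (D.kOf hu) ω := (D.jOf_spec hu).2

/-- Bookkeeping (`one_le_kOf`). [folklore] -/
theorem one_le_kOf (D : IntPairDataA m N k₀ K T R₀ ω) {u : ℕ} {c : Finset (Site 2)} {z : Site 2} (hu : (intDom m).lowestSeq ω u = some (c, z)) :
    1 ≤ D.kOf hu := one_le_trapScale (by have := D.hk₀; omega) _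

/-- Bookkeeping (`two_le_kOf`). [folklore] -/
theorem two_le_kOf (D : IntPairDataA m N k₀ K T R₀ ω) {u : ℕ} {c : Finset (Site 2)} {z : Site 2} (hu : (intDom m).lowestSeq ω u = some (c, z)) :
    2 ≤ D.kOf hu := Nat.mul_le_mul D.hk₀ (Nat.one_le_pow _ _ (by norm_num))

/-- Bookkeeping (`kOf_lt`): `4 · 16 k < m`. [folklore] -/
theorem kOf_lt (D : IntPairDataA m N k₀ K T R₀ ω) {u : ℕ} {c : Finset (Site 2)} {z : Site 2} (hu : (intDom m).lowestSeq ω u = some (c, z)) :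
    4 * (16 * D.kOf hu) < m := D.hKm _ (D.jOf_spec hu).1

/-- Bookkeeping (`tip_midOf`). [folklore] -/
theorem tip_midOf (D : IntPairDataA m N k₀ K T R₀ ω) {u : ℕ} {c : Finset (Site 2)} {z : Site 2} (hu : (intDom m).lowestSeq ω u = some (c, z)) :
    -(m : ℤ) + 32 * D.kOf hu + 1 ≤ z 1 ∧ z 1 ≤ -(32 * (D.kOf hu : ℤ) + 1) := D.tip_mid hu (D.jOf_spec hu).1

/-- Bookkeeping (`c_subset_S`). [folklore] -/
theorem c_subset_S (D : IntPairDataA m N k₀ K T R₀ ω) (c : Finset (Site 2)) : (↑c : Set (Site 2)) ⊆ D.S c := Set.subset_union_left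

/-- Bookkeeping (`S_norm_ge`). [folklore] -/
theorem S_norm_ge (D : IntPairDataA m N k₀ K T R₀ ω) {u : ℕ} {c : Finset (Site 2)} {z : Site 2} (hu : (intDom m).lowestSeq ω u = some (c, z)) :
    ∀ v ∈ D.S c, (m : ℤ) ≤ triNorm v := by
  rintro v (hv | hv)
  · exact (term_norm hu (Finset.mem_coe.1 hv)).1
  · exact D.armSet_norm_ge hv

/-- **The inner fence of the term, stopped at `c ∪ (arms)`.** [cite: Nolin2008, §4.4 Lemma 15 (proof), internal extremities (arXiv 0711.4948: Lemma 14)] -/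
def fence (D : IntPairDataA m N k₀ K T R₀ ω) {u : ℕ} {c : Finset (Site 2)} {z : Site 2} (hu : (intDom m).lowestSeq ω u = some (c, z)) :
    IntTermFence m c z (D.kOf hu) ω (D.S c) :=
  Classical.choice ((D.raw hu).nonempty_intTermFence D.hm (D.one_le_kOf hu) (term_isCrossing hu)
    (by have := D.tip_midOf hu; omega) (D.c_subset_S c) (D.S_norm_ge hu))

/-! ### The admissible set and the targets -/

/-- **The admissible sites**: the arms, the terms, the connections of their fences. [cite: Nolin2008, §4.4 Lemma 15 (proof) (arXiv 0711.4948: Lemma 14)] -/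
def Aset (D : IntPairDataA m N k₀ K T R₀ ω) : Set (Site 2) :=
  D.armSet ∪ {v | ∃ (u : ℕ) (c : Finset (Site 2)) (z : Site 2) (hu : (intDom m).lowestSeq ω u = some (c, z)),
    v ∈ (↑c : Set (Site 2)) ∨ v ∈ (D.fence hu).F}

/-- **The targets**: the exterior fence sites of the terms. [cite: Nolin2008, §4.4 Lemma 15 (proof) (arXiv 0711.4948: Lemma 14)] -/
def Tset (D : IntPairDataA m N k₀ K T R₀ ω) : Set (Site 2) :=
  {v | ∃ (u : ℕ) (c : Finset (Site 2)) (z : Site 2) (hu : (intDom m).lowestSeq ω u = some (c, z)), v = (D.fence hu).m'}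

/-- Bookkeeping (`armSet_subset_Aset`). [folklore] -/
theorem armSet_subset_Aset (D : IntPairDataA m N k₀ K T R₀ ω) : D.armSet ⊆ D.Aset := Set.subset_union_left

/-- Bookkeeping (`term_subset_Aset`). [folklore] -/
theorem term_subset_Aset (D : IntPairDataA m N k₀ K T R₀ ω) {u : ℕ} {c : Finset (Site 2)} {z : Site 2} (hu : (intDom m).lowestSeq ω u = some (c, z)) :
    (↑c : Set (Site 2)) ⊆ D.Aset := fun _ hv => Or.inr ⟨u, c, z, hu, Or.inl hv⟩

/-- Bookkeeping (`fence_subset_Aset`). [folklore] -/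
theorem fence_subset_Aset (D : IntPairDataA m N k₀ K T R₀ ω) {u : ℕ} {c : Finset (Site 2)} {z : Site 2} (hu : (intDom m).lowestSeq ω u = some (c, z)) :
    (D.fence hu).F ⊆ D.Aset := fun _ hv => Or.inr ⟨u, c, z, hu, Or.inr hv⟩

/-- Bookkeeping (`m_mem_Tset`). [folklore] -/
theorem m'_mem_Tset (D : IntPairDataA m N k₀ K T R₀ ω) {u : ℕ} {c : Finset (Site 2)} {z : Site 2} (hu : (intDom m).lowestSeq ω u = some (c, z)) :
    (D.fence hu).m' ∈ D.Tset := ⟨u, c, z, hu, rfl⟩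

/-- The admissible sites are open. [folklore] -/
theorem Aset_subset (D : IntPairDataA m N k₀ K T R₀ ω) : D.Aset ⊆ ω := by
  rintro v (hv | ⟨u, c, z, hu, hv | hv⟩)
  · exact D.armSet_subset hv
  · exact term_open hu hv
  · exact intFenceSet_subset ((D.fence hu).F_subset hv)

/-! ### The planar position of the fences -/

/-- The connection of a fence avoids the arms. [folklore] -/
theorem fence_disjoint_arm (D : IntPairDataA m N k₀ K T R₀ ω) {u : ℕ} {c : Finset (Site 2)} {z : Site 2} (hu : (intDom m).lowestSeq ω u = some (c, z))
    {v : Site 2} (hv : v ∈ (D.fence hu).F) : v ∉ D.armSet := fun h =>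
  intFenceSet_disjoint ((D.fence hu).F_subset hv) (Or.inr h)

/-- The connection of a fence avoids every term. [cite: Nolin2008, §4.4 Lemma 15 (proof) (arXiv 0711.4948: Lemma 14)] -/
theorem fence_disjoint_term (D : IntPairDataA m N k₀ K T R₀ ω) {u v : ℕ} {c c' : Finset (Site 2)} {z z' : Site 2}
    (hu : (intDom m).lowestSeq ω u = some (c, z)) (hv : (intDom m).lowestSeq ω v = some (c', z'))
    {x : Site 2} (hx : x ∈ (D.fence hu).F) : x ∉ c' := by
  rcases lt_trichotomy v u with h | rfl | h
  · exact (D.fence hu).not_mem_of_subset_below (D.term_below_of_lt h hv hu) hx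
  · have := (term_eq hu hv).1; subst this
    exact fun h => intFenceSet_disjoint ((D.fence hu).F_subset hx) (Or.inl (Finset.mem_coe.2 h))
  · exact (D.fence hu).not_mem_of_offLower (D.raw hu) (D.one_le_kOf hu) (by have := D.kOf_lt hu; omega)
      (term_isCrossing hu) (term_isCrossing hv) (term_open hv) (D.term_offLower_of_lt h hu hv) hx

/-- **Tips of distinct terms are far apart** in the scale of the lower one: `z 1 + 17 k_u < z' 1`
for `u < v`. [cite: Nolin2008, §4.4 Lemma 15 (proof) (arXiv 0711.4948: Lemma 14)] -/
theorem row_gap_of_lt (D : IntPairDataA m N k₀ K T R₀ ω) {u v : ℕ} (huv : u < v) {c c' : Finset (Site 2)} {z z' : Site 2}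
    (hu : (intDom m).lowestSeq ω u = some (c, z)) (hv : (intDom m).lowestSeq ω v = some (c', z')) :
    z 1 + 17 * D.kOf hu < z' 1 :=
  (D.raw hu).row_gap (D.one_le_kOf hu) (D.kOf_lt hu) (term_isCrossing hu) (term_isCrossing hv) (term_open hv)
    (D.term_offLower_of_lt huv hu hv) (D.tip_lt_of_lt huv hu hv)

/-- **Connections of distinct fences are disjoint.** [cite: Nolin2008, §4.4 Lemma 15 (proof) (arXiv 0711.4948: Lemma 14)] -/
theorem fence_disjoint_fence (D : IntPairDataA m N k₀ K T R₀ ω) {u v : ℕ} (huv : u ≠ v) {c c' : Finset (Site 2)} {z z' : Site 2}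
    (hu : (intDom m).lowestSeq ω u = some (c, z)) (hv : (intDom m).lowestSeq ω v = some (c', z'))
    {x : Site 2} (hx : x ∈ (D.fence hu).F) : x ∉ (D.fence hv).F := by
  intro hx'
  wlog h : u < v generalizing u v c c' z z'
  · exact this huv.symm hv hu hx' hx (lt_of_le_of_ne (not_lt.1 h) huv.symm)
  have hgap := D.row_gap_of_lt h hu hv
  have hk := D.one_le_kOf hu
  by_cases hn : (m : ℤ) ≤ triNorm x
  · have hxa := (mem_intFenceSet_inside ((D.fence hv).F_subset hx') hn).2.1
    exact (D.fence hu).not_mem_above_of_row_lt D.hm hk (tip_isIntJ' hu) (by have := D.tip_midOf hu; omega) (term_isCrossing hv)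
      (by omega) (fun w hw => D.fence_disjoint_term hu hv hw) hx hn hxa
  · rw [not_le] at hn
    have h1 := mem_intFenceSet_beyond ((D.fence hv).F_subset hx') hn
    have h2 := (intFenceSet_box ((D.fence hu).F_subset hx)).2.2.2
    omega

/-- **A site lies in the structure `c_u ∪ F_u` of at most one term.** [folklore] -/
theorem term_eq_of_mem_struct (D : IntPairDataA m N k₀ K T R₀ ω) {u v : ℕ} {c c' : Finset (Site 2)} {z z' : Site 2}
    (hu : (intDom m).lowestSeq ω u = some (c, z)) (hv : (intDom m).lowestSeq ω v = some (c', z'))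
    {x : Site 2} (hxu : x ∈ (↑c : Set (Site 2)) ∨ x ∈ (D.fence hu).F) (hxv : x ∈ (↑c' : Set (Site 2)) ∨ x ∈ (D.fence hv).F) :
    u = v := by
  by_contra hne
  rcases hxu with hxu | hxu <;> rcases hxv with hxv | hxv
  · rcases lt_or_gt_of_ne hne with h | h
    · exact Finset.disjoint_left.1 (D.term_disjoint_of_lt h hu hv) (Finset.mem_coe.1 hxu) (Finset.mem_coe.1 hxv)
    · exact Finset.disjoint_left.1 (D.term_disjoint_of_lt h hv hu) (Finset.mem_coe.1 hxv) (Finset.mem_coe.1 hxu)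
  · exact D.fence_disjoint_term hv hu hxv (Finset.mem_coe.1 hxu)
  · exact D.fence_disjoint_term hu hv hxu (Finset.mem_coe.1 hxv)
  · exact D.fence_disjoint_fence hne hu hv hxu hxv

/-- The fence site of a term is inside `Λ_m`. [folklore] -/
theorem norm_m' (D : IntPairDataA m N k₀ K T R₀ ω) {u : ℕ} {c : Finset (Site 2)} {z : Site 2} (hu : (intDom m).lowestSeq ω u = some (c, z)) :
    triNorm (D.fence hu).m' < m := (D.fence hu).norm_m' (D.one_le_kOf hu) (tip_isIntJ' hu) (by have := D.tip_midOf hu; omega)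

/-- Distinct terms have distinct fence sites. [folklore] -/
theorem m'_ne_of_ne (D : IntPairDataA m N k₀ K T R₀ ω) {u v : ℕ} (huv : u ≠ v) {c c' : Finset (Site 2)} {z z' : Site 2}
    (hu : (intDom m).lowestSeq ω u = some (c, z)) (hv : (intDom m).lowestSeq ω v = some (c', z')) :
    (D.fence hu).m' ≠ (D.fence hv).m' := fun h =>
  D.fence_disjoint_fence huv hu hv (D.fence hu).m'_mem (h ▸ (D.fence hv).m'_mem)

end IntPairDataA



open LatticeModels

namespace IntPairDataA

open IntPairData (term_isCrossing term_open term_norm tip_isIntJ' term_eq)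
open PairData (fin2_eq_of_ne)

variable {m N k₀ K T R₀ : ℕ} {ω : SiteConfig (Site 2)}

/-! ### Final crossings and minimal terms -/

/-- Bookkeeping (`exists_αF`). [folklore] -/
theorem exists_αF (D : IntPairDataA m N k₀ K T R₀ ω) :
    ∃ a : Finset (Site 2), (intDom m).IsCrossing a (D.y 0) ∧ (∀ v ∈ a, v ∈ (D.A 0).support) :=
  by
  classical
  obtain ⟨q, β, γ, -, -, -, -, hsub, hcr⟩ := int_exists_final_crossing_walk (D.A 0) (D.isPath 0)
    (fun v hv => D.norm_ge hv) (D.b_far 0) D.y_isIntJ (D.clean 0)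
  exact ⟨γ.support.toFinset, hcr, fun v hv => hsub v (List.mem_toFinset.1 hv)⟩

/-- **The final crossing of the arm `i`** (as a set of sites). [cite: Nolin2008, §4.4 (arXiv 0711.4948: proof of Lemma 14)] -/
def αF (D : IntPairDataA m N k₀ K T R₀ ω) : Finset (Site 2) := Classical.choose D.exists_αF

/-- Bookkeeping (`αF_isCrossing`). [folklore] -/
theorem αF_isCrossing (D : IntPairDataA m N k₀ K T R₀ ω) : (intDom m).IsCrossing D.αF (D.y 0) :=
  (Classical.choose_spec D.exists_αF).1

/-- Bookkeeping (`αF_subset`). [folklore] -/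
theorem αF_subset (D : IntPairDataA m N k₀ K T R₀ ω) : ∀ v ∈ D.αF, v ∈ (D.A 0).support :=
  (Classical.choose_spec D.exists_αF).2

/-- Bookkeeping (`αF_open`). [folklore] -/
theorem αF_open (D : IntPairDataA m N k₀ K T R₀ ω) : (↑D.αF : Set (Site 2)) ⊆ ω :=
  fun v hv => D.mem_omega (D.αF_subset v (Finset.mem_coe.1 hv))

/-- Bookkeeping (`exists_meet`). [folklore] -/
theorem exists_meet (D : IntPairDataA m N k₀ K T R₀ ω) :
    ∃ u, ∃ c z, (intDom m).lowestSeq ω u = some (c, z) ∧ (D.αF ∩ c).Nonempty := by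
  obtain ⟨u, c, z, hu, hne⟩ := JDomain.exists_lowestSeq_inter_nonempty D.hcut D.αF_isCrossing D.αF_open
  exact ⟨u, c, z, hu, hne⟩

open Classical in
/-- **The minimal term of the arm `i`**: the least index of a term met by its final crossing. [cite: Nolin2008, §4.4 (arXiv 0711.4948: proof of Lemma 14)] -/
def uMin (D : IntPairDataA m N k₀ K T R₀ ω) : ℕ := Nat.find D.exists_meet

open Classical in
/-- Bookkeeping (`uMin_spec`). [folklore] -/
theorem uMin_spec (D : IntPairDataA m N k₀ K T R₀ ω) :
    ∃ c z, (intDom m).lowestSeq ω D.uMin = some (c, z) ∧ (D.αF ∩ c).Nonempty :=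
  Nat.find_spec D.exists_meet

open Classical in
/-- Bookkeeping (`uMin_min`). [folklore] -/
theorem uMin_min (D : IntPairDataA m N k₀ K T R₀ ω) :
    ∀ v < D.uMin, ∀ c z, (intDom m).lowestSeq ω v = some (c, z) → Disjoint D.αF c := by
  intro v hv c z h
  have := Nat.find_min D.exists_meet hv
  push Not at this
  exact Finset.disjoint_iff_inter_eq_empty.2 (this c z h)

/-- The final crossing of the arm `i` lies above every term before its minimal one. [cite: KestenPTM1982, §2.3 Prop. 2.3] -/
theorem αF_stage (D : IntPairDataA m N k₀ K T R₀ ω) :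
    ∀ v c z, v + 1 = D.uMin → (intDom m).lowestSeq ω v = some (c, z) → D.αF ⊆ (intDom m).above c z :=
  fun v c z hv h => JDomain.subset_above_of_forall_disjoint D.αF_isCrossing D.αF_open v
    (fun v' hv' c' z' h' => D.uMin_min v' (by omega) c' z' h') c z h

/-- The minimal term meets the final crossing. [folklore] -/
theorem αF_meet (D : IntPairDataA m N k₀ K T R₀ ω) {c : Finset (Site 2)} {z : Site 2}
    (hu : (intDom m).lowestSeq ω D.uMin = some (c, z)) : (D.αF ∩ c).Nonempty := by
  obtain ⟨c', z', hu', hne⟩ := D.uMin_spec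
  obtain ⟨rfl, rfl⟩ := term_eq hu' hu
  exact hne

/-- Bookkeeping (`y_ne`). [folklore] -/
theorem y_ne (D : IntPairDataA m N k₀ K T R₀ ω) {i j : Fin 2} (hij : i ≠ j) : D.y i ≠ D.y j := fun h =>
  D.disj' hij (D.A i).end_mem_support (by rw [h]; exact (D.A j).end_mem_support)

/-! ### Canonical routes -/

/-- A prefix of an arm avoiding `zz` is an admissible path avoiding `zz`. [folklore] -/
theorem pathIn_prefix (D : IntPairDataA m N k₀ K T R₀ ω) (i : Fin 2) {x : Site 2} (hx : x ∈ (D.A i).support) {zz : Site 2}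
    (hzz : zz ∉ ((D.A i).takeUntil x hx).support) : PathIn triGraph (D.Aset \ {zz}) (D.b i) x := by
  classical
  have hsub : ∀ v ∈ ((D.A i).takeUntil x hx).support, v ∈ D.Aset \ {zz} := fun v hv =>
    ⟨D.armSet_subset_Aset (D.mem_armSet ((D.A i).support_takeUntil_subset_support hx hv)), fun h => hzz (h ▸ hv)⟩
  exact (PathIn.of_walk_mem_support ((D.A i).takeUntil x hx) hsub ((D.A i).takeUntil x hx).end_mem_support).1

/-- **The fence is reached from its attachment site**: `q → p → … → m` avoiding any `zz` off the
connection and different from `q`. [folklore] -/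
theorem pathIn_q_m (D : IntPairDataA m N k₀ K T R₀ ω) {u : ℕ} {c : Finset (Site 2)} {z : Site 2}
    (hu : (intDom m).lowestSeq ω u = some (c, z)) {zz : Site 2} (hzF : zz ∉ (D.fence hu).F)
    (hzq : zz ≠ (D.fence hu).q) (hqA : (D.fence hu).q ∈ D.Aset) :
    PathIn triGraph (D.Aset \ {zz}) (D.fence hu).q (D.fence hu).m' := by
  set Tf := D.fence hu
  have hF : Tf.F ⊆ D.Aset \ {zz} := fun v hv => ⟨D.fence_subset_Aset hu hv, fun h => hzF (h ▸ hv)⟩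
  have hq' : Tf.q ∈ D.Aset \ {zz} := ⟨hqA, fun h => hzq (Set.mem_singleton_iff.1 h).symm⟩
  exact (PathIn.of_adj hq' (hF Tf.path.left_mem) Tf.adj).trans (Tf.path.mono hF)

/-- The attachment site of a fence is admissible. [folklore] -/
theorem q_mem_Aset (D : IntPairDataA m N k₀ K T R₀ ω) {u : ℕ} {c : Finset (Site 2)} {z : Site 2}
    (hu : (intDom m).lowestSeq ω u = some (c, z)) : (D.fence hu).q ∈ D.Aset := by
  rcases (D.fence hu).q_mem with h | h
  · exact D.term_subset_Aset hu h
  · exact D.armSet_subset_Aset h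

/-- **The canonical route of the arm `i`, avoiding `zz`.** If `zz` is off the arms, off the minimal
term `c` of the arm `i` and off the connection of its fence, some start is joined to the fence
site `m` of `c` by an admissible path avoiding `zz`: along an arm to the attachment site when the
fence is attached to an arm, else along the arm `i` to its final crossing's site on `c`, inside
`c` to the attachment site, then through the connection. [cite: Nolin2008, §4.4 Lemma 15 (proof) (arXiv 0711.4948: Lemma 14)] -/
theorem exists_route (D : IntPairDataA m N k₀ K T R₀ ω) {c : Finset (Site 2)} {z : Site 2}
    (hu : (intDom m).lowestSeq ω D.uMin = some (c, z)) {zz : Site 2} (hzarm : zz ∉ D.armSet)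
    (hzc : zz ∉ c) (hzF : zz ∉ (D.fence hu).F) : ∃ i', PathIn triGraph (D.Aset \ {zz}) (D.b i') (D.fence hu).m' := by
  classical
  set Tf := D.fence hu
  have hqA := D.q_mem_Aset hu
  rcases Tf.q_mem with hq | ⟨i', hq⟩
  · -- attached to the term: arm `i` to its site `x` on `c`, then inside `c`
    have hzq : zz ≠ Tf.q := fun h => hzc (h ▸ Finset.mem_coe.1 hq)
    obtain ⟨x, hx⟩ := D.αF_meet hu
    rw [Finset.mem_inter] at hx
    have hxA : x ∈ (D.A 0).support := D.αF_subset x hx.1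
    have h1 : PathIn triGraph (D.Aset \ {zz}) (D.b 0) x :=
      D.pathIn_prefix 0 hxA fun h => hzarm (D.mem_armSet ((D.A 0).support_takeUntil_subset_support hxA h))
    have h2 : PathIn triGraph (D.Aset \ {zz}) x Tf.q :=
      ((term_isCrossing hu).conn x hx.2 Tf.q (Finset.mem_coe.1 hq)).mono fun v hv =>
        ⟨D.term_subset_Aset hu hv, fun h => hzc (h ▸ Finset.mem_coe.1 hv)⟩
    exact ⟨0, (h1.trans h2).trans (D.pathIn_q_m hu hzF hzq hqA)⟩
  · -- attached to the arm `i'`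
    have hzq : zz ≠ Tf.q := fun h => hzarm (h ▸ ⟨i', hq⟩)
    have h1 : PathIn triGraph (D.Aset \ {zz}) (D.b i') Tf.q :=
      D.pathIn_prefix i' hq fun h => hzarm (D.mem_armSet ((D.A i').support_takeUntil_subset_support hq h))
    exact ⟨i', h1.trans (D.pathIn_q_m hu hzF hzq hqA)⟩

/-- The origin is not admissible (arm and term sites have norm `≥ m ≥ 5`, fence sites have
`v₀ ≥ m - 2k - 1 > 0`). [folklore] -/
theorem zero_not_mem_Aset (D : IntPairDataA m N k₀ K T R₀ ω) : (0 : Site 2) ∉ D.Aset := by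
  have h0 : triNorm (0 : Site 2) = 0 := by simp [triNorm]
  have hm : (5 : ℤ) ≤ m := by exact_mod_cast D.hm
  rintro (⟨i, hv⟩ | ⟨u, c, z, hu, hv | hv⟩)
  · have := D.norm_ge hv; omega
  · have h1 := (term_norm hu (Finset.mem_coe.1 hv)).1
    omega
  · have hb := intFenceSet_box ((D.fence hu).F_subset hv)
    obtain ⟨hz0, -, -⟩ := tip_isIntJ' hu
    have hk := D.kOf_lt hu
    have h00 : (0 : Site 2) 0 = 0 := rfl
    rw [h00] at hb
    omega

/-- **Some admissible route exists** (Menger's first hypothesis). [folklore] -/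
theorem hone (D : IntPairDataA m N k₀ K T R₀ ω) :
    ∃ (s t : Site 2) (q : triGraph.Walk s t), s ∈ ({D.b 0, D.b 1} : Set (Site 2)) ∧ t ∈ D.Tset ∧ ∀ v ∈ q.support, v ∈ D.Aset := by
  obtain ⟨c, z, hu, -⟩ := D.uMin_spec
  have h0 := D.zero_not_mem_Aset
  obtain ⟨i', hp⟩ := D.exists_route hu (fun h => h0 (D.armSet_subset_Aset h)) (fun h => h0 (D.term_subset_Aset hu h))
    (fun h => h0 (D.fence_subset_Aset hu h))
  obtain ⟨w, hw⟩ := hp.exists_walk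
  refine ⟨D.b i', (D.fence hu).m', w, ?_, D.m'_mem_Tset hu, fun v hv => (hw v hv).1⟩
  fin_cases i' <;> simp

/-! ### The reach set of a candidate cut -/

/-- **The reach set avoiding `zz`**: admissible sites joined to a start by an admissible path
avoiding `zz`. [folklore] -/
def Reach (D : IntPairDataA m N k₀ K T R₀ ω) (zz : Site 2) : Set (Site 2) := {x | ∃ i, PathIn triGraph (D.Aset \ {zz}) (D.b i) x}

/-- **`zz` is a cut**: an admissible site such that no fence site is reached avoiding it. [folklore] -/
def IsCut (D : IntPairDataA m N k₀ K T R₀ ω) (zz : Site 2) : Prop :=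
  zz ∈ D.Aset ∧ ∀ (u : ℕ) (c : Finset (Site 2)) (z : Site 2) (hu : (intDom m).lowestSeq ω u = some (c, z)),
    (D.fence hu).m' ∉ D.Reach zz

/-- Bookkeeping (`reach_subset`). [folklore] -/
theorem reach_subset (D : IntPairDataA m N k₀ K T R₀ ω) {zz x : Site 2} (hx : x ∈ D.Reach zz) : x ∈ D.Aset ∧ x ≠ zz := by
  obtain ⟨i, hp⟩ := hx; exact ⟨hp.right_mem.1, hp.right_mem.2⟩

/-- Bookkeeping (`reach_of_pathIn`). [folklore] -/
theorem reach_of_pathIn (D : IntPairDataA m N k₀ K T R₀ ω) {zz x y : Site 2} (hx : x ∈ D.Reach zz)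
    (hp : PathIn triGraph (D.Aset \ {zz}) x y) : y ∈ D.Reach zz := by
  obtain ⟨i, hpx⟩ := hx; exact ⟨i, hpx.trans hp⟩

/-- Bookkeeping (`reach_of_adj`). [folklore] -/
theorem reach_of_adj (D : IntPairDataA m N k₀ K T R₀ ω) {zz x y : Site 2} (hx : x ∈ D.Reach zz) (hy : y ∈ D.Aset) (hyz : y ≠ zz)
    (hadj : triGraph.Adj x y) : y ∈ D.Reach zz :=
  D.reach_of_pathIn hx (PathIn.of_adj (D.reach_subset hx |> fun h => ⟨h.1, h.2⟩) ⟨hy, hyz⟩ hadj)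

/-- A vertex of an arm whose prefix avoids `zz` is reached. [folklore] -/
theorem mem_reach_of_prefix (D : IntPairDataA m N k₀ K T R₀ ω) (i : Fin 2) {x : Site 2} (hx : x ∈ (D.A i).support) {zz : Site 2}
    (hzz : zz ∉ ((D.A i).takeUntil x hx).support) : x ∈ D.Reach zz := ⟨i, D.pathIn_prefix i hx hzz⟩

/-- An arm avoiding `zz` is reached entirely. [folklore] -/
theorem arm_subset_reach (D : IntPairDataA m N k₀ K T R₀ ω) (j : Fin 2) {zz : Site 2} (hzz : zz ∉ (D.A j).support) :
    ∀ x ∈ (D.A j).support, x ∈ D.Reach zz := fun _ hx =>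
  D.mem_reach_of_prefix j hx fun h => hzz ((D.A j).support_takeUntil_subset_support hx h)

/-- A term off `zz` with a reached site is reached entirely. [folklore] -/
theorem term_subset_reach (D : IntPairDataA m N k₀ K T R₀ ω) {u : ℕ} {c : Finset (Site 2)} {z : Site 2}
    (hu : (intDom m).lowestSeq ω u = some (c, z)) {zz : Site 2} (hzc : zz ∉ c) {x : Site 2} (hx : x ∈ c)
    (hxr : x ∈ D.Reach zz) : ∀ x' ∈ c, x' ∈ D.Reach zz := fun x' hx' =>
  D.reach_of_pathIn hxr (((term_isCrossing hu).conn x hx x' hx').mono fun _ hv =>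
    ⟨D.term_subset_Aset hu hv, fun h => hzc (h ▸ Finset.mem_coe.1 hv)⟩)

/-- **Under a cut, no site of a fence connection off `zz` is reached.** [folklore] -/
theorem fence_not_reach (D : IntPairDataA m N k₀ K T R₀ ω) {zz : Site 2} (hcutz : D.IsCut zz) {u : ℕ} {c : Finset (Site 2)} {z : Site 2}
    (hu : (intDom m).lowestSeq ω u = some (c, z)) (hzF : zz ∉ (D.fence hu).F) :
    ∀ x ∈ (D.fence hu).F, x ∉ D.Reach zz := fun _ hx hxr =>
  hcutz.2 u c z hu (D.reach_of_pathIn hxr (((D.fence hu).pathIn_to_m' hx).mono fun _ hv =>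
    ⟨D.fence_subset_Aset hu hv, fun h => hzF (h ▸ hv)⟩))

/-- **Under a cut, the attachment site of a fence off `zz` is not reached.** [folklore] -/
theorem q_not_reach (D : IntPairDataA m N k₀ K T R₀ ω) {zz : Site 2} (hcutz : D.IsCut zz) {u : ℕ} {c : Finset (Site 2)} {z : Site 2}
    (hu : (intDom m).lowestSeq ω u = some (c, z)) (hzF : zz ∉ (D.fence hu).F) : (D.fence hu).q ∉ D.Reach zz :=
  fun hq => D.fence_not_reach hcutz hu hzF _ (D.fence hu).path.left_mem
    (D.reach_of_adj hq (D.fence_subset_Aset hu (D.fence hu).path.left_mem) (fun h => hzF (h ▸ (D.fence hu).path.left_mem)) (D.fence hu).adj)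

end IntPairDataA



open LatticeModels

/-! ### Good sets and the planar contradictions -/

namespace IntPairDataA

open IntPairData (term_isCrossing term_open term_norm tip_isIntJ' term_eq)
open PairData (fin2_eq_of_ne)

variable {m N k₀ K T R₀ : ℕ} {ω : SiteConfig (Site 2)}

/-- **A good set** for the arm `0` (minimal term `c = c_{u_0}`): an open connected set of sites
of the trapezoid avoiding the final crossing `α_j` and every term before `c`. [folklore] -/
structure GoodSet (D : IntPairDataA m N k₀ K T R₀ ω) (S : Set (Site 2)) : Prop where
  sub_D : S ⊆ ↑(haFin m)
  sub_ω : S ⊆ ω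
  conn : SiteConn S
  avoid : ∀ v ∈ S, v ∉ D.αF
  stage : ∀ v' < D.uMin, ∀ c' z', (intDom m).lowestSeq ω v' = some (c', z') → ∀ v ∈ S, v ∉ c'

namespace GoodSet

variable {D : IntPairDataA m N k₀ K T R₀ ω} {A B : Set (Site 2)}

/-- Union of good sets linked by a common site or an edge. [folklore] -/
theorem union_of_link (hA : D.GoodSet A) (hB : D.GoodSet B) {a b : Site 2} (ha : a ∈ A) (hb : b ∈ B)
    (hlink : a = b ∨ triGraph.Adj a b) : D.GoodSet (A ∪ B) where
  sub_D := Set.union_subset hA.sub_D hB.sub_D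
  sub_ω := Set.union_subset hA.sub_ω hB.sub_ω
  conn := by
    rcases hlink with rfl | hadj
    · exact hA.conn.union_of_mem hB.conn ha hb
    · exact hA.conn.union_of_adj hB.conn ha hb hadj
  avoid := fun v hv => hv.elim (hA.avoid v) (hB.avoid v)
  stage := fun v' hv' c' z' h v hv => hv.elim (hA.stage v' hv' c' z' h v) (hB.stage v' hv' c' z' h v)

/-- A good set lies in `D ∖ α_j`. [folklore] -/
theorem sub_sdiff (hA : D.GoodSet A) : A ⊆ (↑((intDom m).D \ D.αF) : Set (Site 2)) := fun w hw => by
  rw [Finset.coe_sdiff]; exact ⟨hA.sub_D hw, fun h => hA.avoid w hw h⟩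

end GoodSet

/-- **Lemma B for a good set (no low bypass)**: a good set starting on `trapI M` whose only site
on `trapO M` is `b`, lower than the tip of `α_j`, is impossible — it is an open crossing of the
stage of `c` disjoint from `α_j`, so `α_j` could not meet `c`. [cite: Nolin2008, §4.4 Lemma 15 (proof) (arXiv 0711.4948: Lemma 14, last paragraph)] -/
theorem GoodSet.false_of_tip {D : IntPairDataA m N k₀ K T R₀ ω} {S : Set (Site 2)} (hS : D.GoodSet S)
    {c : Finset (Site 2)} {z : Site 2} (hu : (intDom m).lowestSeq ω D.uMin = some (c, z))
    (hf : ∃ f ∈ S, f ∈ (intDom m).F) {b : Site 2} (hbS : b ∈ S) (hbO : b ∈ (intDom m).J)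
    (htip : ∀ v ∈ S, v ∈ (intDom m).J → v = b) (hlt : b 1 < (D.y 0) 1) : False := by
  classical
  have hcut := D.hcut
  have hfin : S.Finite := (Finset.finite_toSet (haFin m)).subset hS.sub_D
  set Kf := hfin.toFinset with hKf'
  have hcoe : (↑Kf : Set (Site 2)) = S := hfin.coe_toFinset
  have hmem : ∀ v, v ∈ Kf ↔ v ∈ S := fun v => hfin.mem_toFinset
  have hcr : (intDom m).IsCrossing Kf b :=
    { subset := fun v hv => Finset.mem_coe.1 (hS.sub_D ((hmem v).1 hv))
      tip_mem := (hmem b).2 hbS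
      tip_mem_J := hbO
      eq_tip := fun v hv hvJ => htip v ((hmem v).1 hv) hvJ
      exists_start := by obtain ⟨f, hf, hfI⟩ := hf; exact ⟨f, (hmem f).2 hf, hfI⟩
      conn := fun u hu' v hv => by rw [hcoe]; exact hS.conn u ((hmem u).1 hu') v ((hmem v).1 hv) }
  have hKfω : (↑Kf : Set (Site 2)) ⊆ ω := by rw [hcoe]; exact hS.sub_ω
  have hdisjα : Disjoint Kf D.αF := Finset.disjoint_left.2 fun v hv hv' => hS.avoid v ((hmem v).1 hv) hv'
  have hKabove : ∀ v' c' z', v' + 1 = D.uMin → (intDom m).lowestSeq ω v' = some (c', z') →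
      Kf ⊆ (intDom m).above c' z' :=
    fun v' c' z' hv' h => JDomain.subset_above_of_forall_disjoint hcr hKfω v'
      (fun v'' hv'' c'' z'' h'' => Finset.disjoint_left.2 fun x hx hx'' =>
        hS.stage v'' (by omega) c'' z'' h'' x ((hmem x).1 hx) hx'') c' z' h
  have := JDomain.disjoint_of_stage_crossing hcut D.hdual hu hcr hKfω hKabove (D.αF_isCrossing) hdisjα
    (by simpa using hlt)
  obtain ⟨x, hx⟩ := D.αF_meet hu
  rw [Finset.mem_inter] at hx
  exact Finset.disjoint_left.1 this hx.1 hx.2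

/-- **Lemma A for a good set (no high bypass)**: a good set containing a site of `Tp` or of the
tip arc above the tip of `α_j` contains no site of `c`. [cite: Nolin2008, §4.4 Lemma 15 (proof) (arXiv 0711.4948: Lemma 14, last paragraph)] -/
theorem GoodSet.not_mem_term {D : IntPairDataA m N k₀ K T R₀ ω} {S : Set (Site 2)} (hS : D.GoodSet S)
    {c : Finset (Site 2)} {z : Site 2} (hu : (intDom m).lowestSeq ω D.uMin = some (c, z))
    {r : Site 2} (hrS : r ∈ S) (hr : r ∈ (intDom m).Tp ∪ (intDom m).Jabove (D.y 0)) :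
    ∀ v ∈ S, v ∉ c := fun _ hvS hvc =>
  Set.disjoint_left.1 (JDomain.disjoint_term_of_conn_ref D.hcut D.hdual hu (D.αF_isCrossing)
    (D.αF_open) (D.αF_stage) hS.sub_sdiff hS.conn hrS hr) hvS (Finset.mem_coe.2 hvc)

/-- **The tip of the minimal term is lower than the tip of the arm** when it is off `α_j`. [folklore] -/
theorem tip_row_lt (D : IntPairDataA m N k₀ K T R₀ ω) {c : Finset (Site 2)} {z : Site 2}
    (hu : (intDom m).lowestSeq ω D.uMin = some (c, z)) (hzα : z ∉ D.αF) : z 1 < (D.y 0) 1 := by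
  have hcut := D.hcut
  have hc := term_isCrossing hu
  have hα := D.αF_isCrossing
  have hL : c ⊆ (intDom m).lower D.αF (D.y 0) :=
    JDomain.term_subset_lower hcut D.hdual hu hα (D.αF_open) (D.αF_stage)
  have hzO := (term_isCrossing hu).tip_mem_J
  have hzy : z ≠ D.y 0 := fun h => hzα (h ▸ hα.tip_mem)
  have hle : ¬ (D.y 0) 1 < z 1 := fun hlt => by
    have hza : z ∈ (intDom m).above D.αF (D.y 0) := hα.mem_above_of_mem_Jabove (JDomain.mem_Jabove.2 ⟨hzO, by simpa using hlt⟩)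
    exact (JDomain.mem_lower_iff_not_mem_above (hc.subset hc.tip_mem)).1 (hL hc.tip_mem) hza
  have hne : z 1 ≠ (D.y 0) 1 := fun h => hzy (Site.eq_iff_two.2 ⟨(mem_intDom_J.1 hzO).2.1.trans D.y_isIntJ.1.symm, h⟩)
  omega

/-- **A good set through the tip of the minimal term** (starting on `trapI M`, meeting `trapO M`
only at `z`) is impossible. [cite: Nolin2008, §4.4 Lemma 15 (proof) (arXiv 0711.4948: Lemma 14, last paragraph)] -/
theorem GoodSet.false_of_tip_mem {D : IntPairDataA m N k₀ K T R₀ ω} {S : Set (Site 2)} (hS : D.GoodSet S)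
    {c : Finset (Site 2)} {z : Site 2} (hu : (intDom m).lowestSeq ω D.uMin = some (c, z))
    (hf : ∃ f ∈ S, f ∈ (intDom m).F) (hzS : z ∈ S) (htip : ∀ v ∈ S, v ∈ (intDom m).J → v = z) : False :=
  hS.false_of_tip hu hf hzS (term_isCrossing hu).tip_mem_J htip (D.tip_row_lt hu (hS.avoid z hzS))

/-- **A good set attached to the fence of the minimal term** — containing a site `w₀` of `c` and
the attachment site `q` of the fence of `c`, starting on `trapI M`, and missing `trapO M` — is
impossible: follow the fence connection from `q` out of `Λ_{2M}` (see the module docstring). [cite: Nolin2008, §4.4 Lemma 15 (proof) (arXiv 0711.4948: Lemma 14, last paragraph)] -/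
theorem GoodSet.false_of_fence {D : IntPairDataA m N k₀ K T R₀ ω} {S : Set (Site 2)} (hS : D.GoodSet S)
    {c : Finset (Site 2)} {z : Site 2} (hu : (intDom m).lowestSeq ω D.uMin = some (c, z))
    (hf : ∃ f ∈ S, f ∈ (intDom m).F) (hO : ∀ v ∈ S, v ∉ (intDom m).J) {w₀ : Site 2} (hw₀ : w₀ ∈ S) (hw₀c : w₀ ∈ c)
    (hq : (D.fence hu).q ∈ S) : False := by
  classical
  have hcut := D.hcut
  have hc := term_isCrossing hu
  have hzO : z ∈ (intDom m).J := (term_isCrossing hu).tip_mem_J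
  have hk := D.one_le_kOf hu
  set Tf := D.fence hu with hTf
  have hqO : Tf.q ∉ (intDom m).J := hO _ hq
  have hqD : Tf.q ∈ haFin m := hS.sub_D hq
  have hqz : Tf.q ≠ z := fun h => hqO (by rw [h]; exact hzO)
  obtain ⟨hz0, hz1, hz2⟩ := (mem_intDom_J.1 hzO).2
  have hmid := D.tip_midOf hu
  have hk' : (1 : ℤ) ≤ D.kOf hu := by exact_mod_cast hk
  have hpbox := intFenceSet_box (Tf.F_subset Tf.path.left_mem)
  have hqp := (triGraph_adj_iff_coord Tf.q Tf.p).1 Tf.adj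
  by_cases hpn : (m : ℤ) ≤ triNorm Tf.p
  swap
  · rw [not_le] at hpn
    have hrow := mem_intFenceSet_beyond (Tf.F_subset Tf.path.left_mem) hpn
    have hqn : triNorm Tf.q = m := by
      have h1 := (mem_haFin.1 hqD).2.1
      have h2 := triNorm_le_triNorm_add_one_of_adj Tf.adj.symm
      omega
    have hq0 : Tf.q 0 = m := by
      have hqn' := hqn
      rw [triNorm_eq_max] at hqn'
      rcases hqp with h | h | h | h | h | h <;> omega
    have hN : Tf.q ∈ (intDom m).Tp ∪ (intDom m).Jabove z := by
      rcases int_sType_or_nType hqD hqn (Or.inl hq0) hzO hqz with hS' | hN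
      · exfalso
        simp only [Finset.mem_union, mem_intDom_Bt, JDomain.mem_Jbelow, mem_intDom_J, intDom_ht] at hS'
        have hq1 : z 1 ≤ Tf.q 1 := by rcases hqp with h | h | h | h | h | h <;> omega
        have hqz1 : Tf.q 1 ≠ z 1 := fun h => hqz (Site.eq_iff_two.2 ⟨hq0.trans hz0.symm, h⟩)
        rcases hS' with ⟨-, -, hB⟩ | ⟨-, hlt⟩
        · rcases hB with h | ⟨-, h⟩ <;> omega
        · omega
      · exact hN
    have hqTp : Tf.q ∈ (intDom m).Tp := by
      rcases Finset.mem_union.1 hN with h | h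
      · exact h
      · exact absurd (JDomain.mem_Jabove.1 h).1 hqO
    exact hS.not_mem_term hu hq (Finset.mem_union_left _ hqTp) w₀ hw₀ hw₀c
  -- follow the connection from `p` to its first exit
  obtain ⟨x', e, hx'n, hen, -, hadj, hpath⟩ := Tf.exists_exit hk (tip_isIntJ' hu) (by omega) Tf.path.left_mem hpn
  obtain ⟨S₁, hS₁, hpS₁, htS₁⟩ := hpath.exists_support
  have hS₁F : ∀ v ∈ S₁, v ∈ Tf.F := fun v hv => (hS₁ hv).2
  have hS₁n : ∀ v ∈ S₁, (m : ℤ) ≤ triNorm v := fun v hv => (hS₁ hv).1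
  have hS₁in : ∀ v ∈ S₁, v ∈ haFin m ∧ v ∈ (intDom m).above c z ∧ v ∉ c := fun v hv =>
    mem_intFenceSet_inside (Tf.F_subset (hS₁F v hv)) (hS₁n v hv)
  have hS₁arm : ∀ v ∈ S₁, v ∉ D.armSet := fun v hv => D.fence_disjoint_arm hu (hS₁F v hv)
  have hS₁good : D.GoodSet S₁ :=
    { sub_D := fun v hv => Finset.mem_coe.2 (hS₁in v hv).1
      sub_ω := fun v hv => intFenceSet_subset (Tf.F_subset (hS₁F v hv))
      conn := fun x hx y hy => (htS₁ x hx).symm.trans (htS₁ y hy)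
      avoid := fun v hv h => hS₁arm v hv (D.mem_armSet (D.αF_subset v h))
      stage := fun v' _ c' z' h v hv => D.fence_disjoint_term hu h (hS₁F v hv) }
  have hpS : Tf.p ∈ S₁ := hpS₁.left_mem
  have hbig : D.GoodSet (S ∪ S₁) := hS.union_of_link hS₁good hq hpS (Or.inr Tf.adj)
  by_cases hr : ∃ r ∈ S₁, r ∈ (intDom m).Tp ∪ (intDom m).Jabove (D.y 0)
  · obtain ⟨r, hrS, hr⟩ := hr
    exact hbig.not_mem_term hu (Or.inr hrS) hr w₀ (Or.inl hw₀) hw₀c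
  push Not at hr
  -- rows of the tip-arc sites of `S₁` are below the tip of `α_j`
  have hrowO : ∀ b ∈ S₁, b ∈ (intDom m).J → b 1 < (D.y 0) 1 := by
    intro b hbS hbO
    have h1 : ¬ (D.y 0) 1 < b 1 := fun h => hr b hbS (Finset.mem_union_right _ (JDomain.mem_Jabove.2 ⟨hbO, by simpa using h⟩))
    have h2 : b ≠ D.y 0 := fun h => hS₁arm b hbS (h ▸ D.mem_armSet (D.A 0).end_mem_support)
    have h3 : b 1 ≠ (D.y 0) 1 := fun h => h2 (Site.eq_iff_two.2 ⟨(mem_intDom_J.1 hbO).2.1.trans D.y_isIntJ.1.symm, h⟩)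
    omega
  -- the last half-annulus site `x'` is top-type for `z`, hence on the tip arc
  have hx'S : x' ∈ S₁ := hpS₁.right_mem
  have hx'D := (hS₁in x' hx'S).1
  have hx'b : triNorm x' = m := by have := triNorm_le_triNorm_add_one_of_adj hadj.symm; omega
  have hx'z : x' ≠ z := fun h => (hS₁in x' hx'S).2.2 (h ▸ hc.tip_mem)
  have hx'box := intFenceSet_box (Tf.F_subset (hS₁F x' hx'S))
  have hx'0 : x' 0 = m := by
    have hx'e := (triGraph_adj_iff_coord x' e).1 hadj
    have hx'b' := hx'b
    have hen' := hen
    rw [triNorm_eq_max] at hx'b' hen'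
    rcases hx'e with h | h | h | h | h | h <;> omega
  have hx'O : x' ∈ (intDom m).J := by
    rcases int_sType_or_nType hx'D hx'b (Or.inl hx'0) hzO hx'z with hS' | hN
    · exact absurd (hS₁in x' hx'S).2.1 (hc.not_mem_above_of_mem_Bt_union hcut hS')
    · rcases Finset.mem_union.1 hN with h | h
      · exact absurd (Finset.mem_union_left _ h) (hr x' hx'S)
      · exact (JDomain.mem_Jabove.1 h).1
  -- the first tip-arc site `b` along the connection from `p`, and the continuation `S₂` before it
  obtain ⟨S₂, b, hS₂, hS₂O, hbS, hbO, hgood⟩ : ∃ (S₂ : Set (Site 2)) (b : Site 2), S₂ ⊆ S₁ ∧ (∀ v ∈ S₂, v ∉ (intDom m).J) ∧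
      b ∈ S₁ ∧ b ∈ (intDom m).J ∧ D.GoodSet (S ∪ S₂ ∪ {b}) := by
    have hsingle : ∀ b ∈ S₁, D.GoodSet ({b} : Set (Site 2)) := fun b hb =>
      { sub_D := fun v hv => by rw [Set.mem_singleton_iff.1 hv]; exact hS₁good.sub_D hb
        sub_ω := fun v hv => by rw [Set.mem_singleton_iff.1 hv]; exact hS₁good.sub_ω hb
        conn := siteConn_singleton b
        avoid := fun v hv => by rw [Set.mem_singleton_iff.1 hv]; exact hS₁good.avoid b hb
        stage := fun v' hv' c' z' h v hv => by rw [Set.mem_singleton_iff.1 hv]; exact hS₁good.stage v' hv' c' z' h b hb }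
    by_cases hpO : Tf.p ∈ (intDom m).J
    · refine ⟨∅, Tf.p, Set.empty_subset _, fun v hv => absurd hv (Set.notMem_empty v), hpS, hpO, ?_⟩
      rw [Set.union_empty]
      exact hS.union_of_link (hsingle _ hpS) hq (Set.mem_singleton _) (Or.inr Tf.adj)
    · obtain ⟨a, b, haO, hbO, hbS, hab, hpa⟩ := hpS₁.exit (R := (↑((intDom m).J) : Set (Site 2))ᶜ) hpO (fun h => h hx'O)
      obtain ⟨S₂, hS₂, hpS₂, htS₂⟩ := hpa.exists_support
      have hbO' : b ∈ (intDom m).J := not_not.1 hbO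
      have hS₂S₁ : S₂ ⊆ S₁ := fun v hv => (hS₂ hv).2
      have hS₂good : D.GoodSet S₂ :=
        { sub_D := fun v hv => hS₁good.sub_D (hS₂S₁ hv)
          sub_ω := fun v hv => hS₁good.sub_ω (hS₂S₁ hv)
          conn := fun x hx y hy => (htS₂ x hx).symm.trans (htS₂ y hy)
          avoid := fun v hv => hS₁good.avoid v (hS₂S₁ hv)
          stage := fun v' hv' c' z' h v hv => hS₁good.stage v' hv' c' z' h v (hS₂S₁ hv) }
      refine ⟨S₂, b, hS₂S₁, fun v hv => (hS₂ hv).1, hbS, hbO', ?_⟩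
      exact (hS.union_of_link hS₂good hq hpS₂.left_mem (Or.inr Tf.adj)).union_of_link (hsingle b hbS)
        (Or.inr hpS₂.right_mem) (Set.mem_singleton b) (Or.inr hab)
  -- `S ∪ S₂ ∪ {b}` has the single tip-arc site `b`, lower than the tip of `α_j`: Lemma B
  refine hgood.false_of_tip hu ?_ (Set.mem_union_right _ (Set.mem_singleton b)) hbO ?_ (hrowO b hbS hbO)
  · obtain ⟨f, hf', hfI⟩ := hf; exact ⟨f, Or.inl (Or.inl hf'), hfI⟩
  · rintro v ((hv | hv) | hv) hvO
    · exact absurd hvO (hO v hv)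
    · exact absurd hvO (hS₂O v hv)
    · exact Set.mem_singleton_iff.1 hv

end IntPairDataA



open LatticeModels Literature.Combinatorics.SimpleGraph

namespace IntPairDataA

open IntPairData (term_isCrossing term_open term_norm tip_isIntJ' term_eq)
open PairData (fin2_eq_of_ne)

variable {m N k₀ K T R₀ : ℕ} {ω : SiteConfig (Site 2)}

/-! ### Geometry of an attachment to an arm -/

/-- The far end of an arm is outside the `7k`-box about every term tip. [folklore] -/
theorem b_far_box (D : IntPairDataA m N k₀ K T R₀ ω) (i : Fin 2) {u : ℕ} {c : Finset (Site 2)} {z : Site 2}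
    (hu : (intDom m).lowestSeq ω u = some (c, z)) :
    (D.b i) 0 ≤ z 0 - 7 * D.kOf hu ∨ z 0 + 7 * D.kOf hu ≤ (D.b i) 0 ∨ (D.b i) 1 ≤ z 1 - 7 * D.kOf hu ∨ z 1 + 7 * D.kOf hu ≤ (D.b i) 1 := by
  have h1 := D.b_far i
  obtain ⟨hz0, hz1, hz2⟩ := tip_isIntJ' hu
  have h3 := D.kOf_lt hu
  by_contra h
  push Not at h
  rw [triNorm_eq_max] at h1
  simp only [lt_max_iff] at h1
  omega

/-- **An attachment site on an arm lies in the fence zone above the term**: if the fence of the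
term `c` (tip `z`, scale `k`) is attached at a site `q` of the arm `i` off `c`, then `q` is off
`lower c z` and in the `3k`-box about `z` (`q` is a neighbour of the first connection site `p`:
inside, `p ∈ above c`; outside, `q` is the end of the arm, on the tip arc above `z`). [cite: Nolin2008, §4.4 Lemma 15 (proof) (arXiv 0711.4948: Lemma 14)] -/
theorem attach_geom (D : IntPairDataA m N k₀ K T R₀ ω) {u : ℕ} {c : Finset (Site 2)} {z : Site 2}
    (hu : (intDom m).lowestSeq ω u = some (c, z)) (hqA : (D.fence hu).q ∈ (D.A 1).support)
    (hqc : (D.fence hu).q ∉ c) :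
    (D.fence hu).q ∉ (intDom m).lower c z ∧
      (z 0 - 3 * D.kOf hu ≤ (D.fence hu).q 0 ∧ (D.fence hu).q 0 ≤ z 0 + 3 * D.kOf hu ∧
        z 1 - 3 * D.kOf hu ≤ (D.fence hu).q 1 ∧ (D.fence hu).q 1 ≤ z 1 + 3 * D.kOf hu) := by
  set Tf := D.fence hu
  have hc := term_isCrossing hu
  obtain ⟨hz0, hz1, hz2⟩ := tip_isIntJ' hu
  have hmid := D.tip_midOf hu
  have hk2 := D.two_le_kOf hu
  have hkM := D.kOf_lt hu
  have hpF := Tf.F_subset Tf.path.left_mem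
  have hpbox := intFenceSet_box hpF
  have h0 := triGraph_adj_coord Tf.adj 0
  have h1 := triGraph_adj_coord Tf.adj 1
  have hqn : (m : ℤ) ≤ triNorm Tf.q := D.norm_ge hqA
  have hbox : z 0 - 3 * D.kOf hu ≤ Tf.q 0 ∧ Tf.q 0 ≤ z 0 + 3 * D.kOf hu ∧
      z 1 - 3 * D.kOf hu ≤ Tf.q 1 ∧ Tf.q 1 ≤ z 1 + 3 * D.kOf hu := by omega
  have hqD : Tf.q ∈ haFin m := by
    refine mem_haFin.2 ⟨by omega, hqn, ?_⟩
    rw [triNorm_eq_max]; omega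
  refine ⟨?_, hbox⟩
  have habove : Tf.q ∈ (intDom m).above c z := by
    by_cases hpn : (m : ℤ) ≤ triNorm Tf.p
    · have hpa := (mem_intFenceSet_inside hpF hpn).2.1
      exact JDomain.mem_above_of_adj hpa hqD hqc Tf.adj.symm
    · rw [not_le] at hpn
      have hrow := mem_intFenceSet_beyond hpF hpn
      have hqb : triNorm Tf.q = m := by have := triNorm_le_triNorm_add_one_of_adj Tf.adj.symm; omega
      have hqy : Tf.q = D.y 1 := D.clean 1 _ hqA hqb
      have hyJ : IsIntJ m (D.y 1) := by
        rcases D.yfar with h | h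
        · exact h
        · exfalso
          have := h _ (D.jOf_spec hu).1
          rw [← hqy] at this
          change Tf.q 0 + 3 * (D.kOf hu : ℤ) < m at this
          omega
      have hqO : Tf.q ∈ (intDom m).J := by rw [hqy]; exact mem_J_of_isIntJ hyJ
      have hq0 : Tf.q 0 = m := by rw [hqy]; exact hyJ.1
      have hne : Tf.q 1 ≠ z 1 := fun h => hqc (by rw [Site.eq_iff_two.2 ⟨hq0.trans hz0.symm, h⟩]; exact hc.tip_mem)
      have hq1 : z 1 ≤ Tf.q 1 := by omega
      exact hc.mem_above_of_mem_Jabove (JDomain.mem_Jabove.2 ⟨hqO, by simpa using lt_of_le_of_ne hq1 hne.symm⟩)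
  exact fun hl => (JDomain.mem_lower_iff_not_mem_above hqD).1 hl habove

/-- **If the fence of a term is attached at the end of the arm `1`, that end is on the tip arc.** [folklore] -/
theorem y1_isIntJ_of_q_eq (D : IntPairDataA m N k₀ K T R₀ ω) {u : ℕ} {c : Finset (Site 2)} {z : Site 2}
    (hu : (intDom m).lowestSeq ω u = some (c, z))
    (hqbox : z 0 - 3 * D.kOf hu ≤ (D.fence hu).q 0 ∧ (D.fence hu).q 0 ≤ z 0 + 3 * D.kOf hu ∧
        z 1 - 3 * D.kOf hu ≤ (D.fence hu).q 1 ∧ (D.fence hu).q 1 ≤ z 1 + 3 * D.kOf hu)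
    (hqy : (D.fence hu).q = D.y 1) : IsIntJ m (D.y 1) := by
  rcases D.yfar with h | h
  · exact h
  · exfalso
    have h1 := h _ (D.jOf_spec hu).1
    obtain ⟨hz0, -, -⟩ := tip_isIntJ' hu
    rw [← hqy] at h1
    change (D.fence hu).q 0 + 3 * (D.kOf hu : ℤ) < m at h1
    omega

/-! ### The stage lemma -/

/-- **The stage lemma.** Under the cut hypothesis for a site `zz` of the arm `i`, let `c` be the
minimal term of the other arm `j` and `w₀ ∈ c` a site of the arm `i` at or before `zz` such that
every site of `lower c` on the arm up to `zz` is at or before `w₀`. Then the arm `i` up to `zz`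
meets no term before `c`. [cite: Nolin2008, §4.4 Lemma 15 (proof) (arXiv 0711.4948: Lemma 14, last paragraph)] -/
theorem prefix_disjoint_earlier (D : IntPairDataA m N k₀ K T R₀ ω) {zz : Site 2} (hcutz : D.IsCut zz)
    (hzz : zz ∈ (D.A 1).support) {c : Finset (Site 2)} {z : Site 2}
    (hu : (intDom m).lowestSeq ω D.uMin = some (c, z))
    {w₀ : Site 2} (hw₀c : w₀ ∈ c) (hw₀z : w₀ ∈ ((D.A 1).takeUntil zz hzz).support)
    (hbetween : ∀ v ∈ ((D.A 1).takeUntil zz hzz).support, v ∈ (intDom m).lower c z →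
      v ∈ ((D.A 1).takeUntil w₀ ((D.A 1).support_takeUntil_subset_support hzz hw₀z)).support) :
    ∀ v' < D.uMin, ∀ c' z', (intDom m).lowestSeq ω v' = some (c', z') →
      ∀ t ∈ ((D.A 1).takeUntil zz hzz).support, t ∉ c' := by
  classical
  have hij : (1 : Fin 2) ≠ 0 := by decide
  intro v' hv' c' z' h t ht htc'
  have hw₀A : w₀ ∈ (D.A 1).support := (D.A 1).support_takeUntil_subset_support hzz hw₀z
  have hc'below := D.term_below_of_lt hv' h hu
  have hc'low : ∀ x ∈ c', x ∈ (intDom m).lower c z := fun x hx => JDomain.mem_lower.2 (Or.inr (hc'below hx))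
  have hdisj : Disjoint c' c := D.term_disjoint_of_lt hv' h hu
  -- `zz ∉ c'`
  have hzc' : zz ∉ c' := by
    intro hz'
    have h1 := hbetween zz (SimpleGraph.Walk.end_mem_support _) (hc'low zz hz')
    by_cases hw : w₀ = zz
    · exact Finset.disjoint_left.1 hdisj hz' (hw ▸ hw₀c)
    · exact notMem_takeUntil_of_mem_takeUntil (D.A 1) hzz hw₀z hw hw₀A h1
  have htz : t ≠ zz := fun e => hzc' (e ▸ htc')
  have htA : t ∈ (D.A 1).support := (D.A 1).support_takeUntil_subset_support hzz ht
  -- `t`, hence all of `c'`, is reached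
  have htR : t ∈ D.Reach zz := D.mem_reach_of_prefix 1 htA (notMem_takeUntil_of_mem_takeUntil (D.A 1) hzz ht htz htA)
  have hc'R : ∀ x ∈ c', x ∈ D.Reach zz := D.term_subset_reach h hzc' htc' htR
  -- the fence of `c'` is attached to the arm `i` at or after `zz`
  set Tf := D.fence h with hTf
  have hzF : zz ∉ Tf.F := fun hF => D.fence_disjoint_arm h hF ⟨1, hzz⟩
  have hqR : Tf.q ∉ D.Reach zz := D.q_not_reach hcutz h hzF
  have hqc' : Tf.q ∉ c' := fun hq => hqR (hc'R _ hq)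
  have hqA : Tf.q ∈ (D.A 1).support := by
    rcases Tf.q_mem with hq | ⟨i', hq⟩
    · exact absurd (Finset.mem_coe.1 hq) hqc'
    · by_cases hi' : i' = 0
      · rw [hi'] at hq
        exact absurd (D.arm_subset_reach 0 (D.disj' hij hzz) _ hq) hqR
      · rw [fin2_eq_of_ne hij hi'] at hq; exact hq
  have hzq : zz ∈ ((D.A 1).takeUntil Tf.q hqA).support := by
    by_contra hno
    exact hqR (D.mem_reach_of_prefix 1 hqA hno)
  -- the approach of the arm `i` to the fence zone of `c'`
  obtain ⟨hqlow, hqbox⟩ := D.attach_geom h hqA hqc'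
  have hk := D.one_le_kOf h
  have hkM := D.kOf_lt h
  obtain ⟨ℓ', s', β', hℓs', γ'', hdec, hℓ'c', -, hγ''p, -, -⟩ := int_exists_last_contact (D.raw h) hk (by omega)
    (term_isCrossing h) (D.A 1) (D.isPath 1) (fun v hv => D.norm_ge hv) (fun v hv => D.mem_omega hv) (D.b_far_box 1 h)
    hqA hqbox hqlow
  have hpath : ((D.A 1).takeUntil Tf.q hqA).IsPath := (D.isPath 1).takeUntil _
  have hzℓ' : zz ≠ ℓ' := fun e => hzc' (e ▸ hℓ'c')
  -- position of `zz` in the splitting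
  have hzpos := (SimpleGraph.Walk.mem_support_append_iff _ _).1 (hdec ▸ hzq)
  rcases hzpos with hzβ | hzγ
  · -- `zz` before `ℓ'`: then `ℓ'`, reached, is joined to `q` off `zz`
    have hzr : zz ∉ (SimpleGraph.Walk.cons hℓs' γ'').support := fun hz2 => by
      rcases ((mem_support_right_iff hpath hdec).1 hz2).2 with h' | h'
      · exact h' hzβ
      · exact hzℓ' h'
    have hsub : ∀ v ∈ (SimpleGraph.Walk.cons hℓs' γ'').support, v ∈ D.Aset \ {zz} := fun v hv => by
      have hv' : v ∈ ((D.A 1).takeUntil Tf.q hqA).support := by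
        rw [hdec, SimpleGraph.Walk.mem_support_append_iff]; exact Or.inr hv
      exact ⟨D.armSet_subset_Aset (D.mem_armSet ((D.A 1).support_takeUntil_subset_support hqA hv')), fun e => hzr (e ▸ hv)⟩
    have hp : PathIn triGraph (D.Aset \ {zz}) ℓ' Tf.q :=
      (PathIn.of_walk_mem_support (SimpleGraph.Walk.cons hℓs' γ'') hsub (SimpleGraph.Walk.end_mem_support _)).1
    exact hqR (D.reach_of_pathIn (hc'R ℓ' hℓ'c') hp)
  · -- `zz` at or after `ℓ'`
    rw [SimpleGraph.Walk.support_cons, List.mem_cons] at hzγ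
    rcases hzγ with hz1 | hzγ
    · exact hzℓ' hz1
    -- `w₀` is at or before `zz`, hence in the splitting too
    have hw₀q : w₀ ∈ ((D.A 1).takeUntil Tf.q hqA).support := support_takeUntil_subset_of_mem (D.A 1) hqA hzq hw₀z
    have hw₀ℓ' : w₀ ≠ ℓ' := fun e => Finset.disjoint_left.1 hdisj hℓ'c' (e ▸ hw₀c)
    rcases (SimpleGraph.Walk.mem_support_append_iff _ _).1 (hdec ▸ hw₀q) with hwβ | hwγ
    · -- `w₀` before `ℓ'`: but `ℓ' ∈ lower c` lies before `zz`, hence before `w₀` — contradiction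
      have hβeq : β' = ((D.A 1).takeUntil Tf.q hqA).takeUntil ℓ' (hdec ▸ (SimpleGraph.Walk.mem_support_append_iff _ _).2 (Or.inl β'.end_mem_support)) :=
        prefix_eq_takeUntil hpath hdec _
      have hℓ'A : ℓ' ∈ (D.A 1).support := (D.A 1).support_takeUntil_subset_support hqA
        (hdec ▸ (SimpleGraph.Walk.mem_support_append_iff _ _).2 (Or.inl β'.end_mem_support))
      have hw₀ℓ : w₀ ∈ ((D.A 1).takeUntil ℓ' hℓ'A).support := by
        have : ((D.A 1).takeUntil Tf.q hqA).takeUntil ℓ' (hdec ▸ (SimpleGraph.Walk.mem_support_append_iff _ _).2 (Or.inl β'.end_mem_support)) =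
            (D.A 1).takeUntil ℓ' hℓ'A := SimpleGraph.Walk.takeUntil_takeUntil _ _ _
        rw [← this, ← hβeq]; exact hwβ
      -- `ℓ'` is at or before `zz`: otherwise `zz ∈ takeUntil ℓ' = β'`, but `zz ∈ γ''`
      have hℓ'z : ℓ' ∈ ((D.A 1).takeUntil zz hzz).support := by
        rcases mem_takeUntil_or (D.A 1) hzz hℓ'A with h' | h'
        · exact h'
        · exfalso
          have : ((D.A 1).takeUntil Tf.q hqA).takeUntil ℓ' (hdec ▸ (SimpleGraph.Walk.mem_support_append_iff _ _).2 (Or.inl β'.end_mem_support)) =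
              (D.A 1).takeUntil ℓ' hℓ'A := SimpleGraph.Walk.takeUntil_takeUntil _ _ _
          have hzβ' : zz ∈ β'.support := by rw [hβeq, this]; exact h'
          rcases ((mem_support_right_iff hpath hdec).1 (List.mem_cons_of_mem _ hzγ)).2 with h'' | h''
          · exact h'' hzβ'
          · exact hzℓ' h''
      have h2 := hbetween ℓ' hℓ'z (hc'low ℓ' hℓ'c')
      exact notMem_takeUntil_of_mem_takeUntil (D.A 1) hℓ'A hw₀ℓ hw₀ℓ' hw₀A h2
    · rw [SimpleGraph.Walk.support_cons, List.mem_cons] at hwγ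
      rcases hwγ with hw1 | hwγ
      · exact hw₀ℓ' hw1
      -- `w₀` on the piece off `lower c'` inside the `7k'`-box: the outer ring excludes `w₀ ∈ c`
      obtain ⟨-, -, -, hbox⟩ := hγ''p w₀ hwγ
      exact int_not_mem_of_box7_offLower (D.raw h) hk hkM (term_isCrossing h)
        (term_isCrossing hu) (term_open hu) (D.term_offLower_of_lt hv' h hu) hbox hw₀c

/-! ### The entry piece and the components, as good sets -/

/-- **The entry piece of the arm `i` at `zz`, as a good set.** For a site `zz` of the arm `i`
(`zz₀ > M`) such that the arm up to `zz` avoids the terms before `c = c_{u_j}` (`j ≠ i`), the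
piece inside the trapezoid ending at `zz` is a good set for `j` starting on `trapI M`, containing
`zz`, made of sites of the arm up to `zz`, meeting `trapO M` at most at `zz`. [folklore] -/
theorem exists_entry_goodSet (D : IntPairDataA m N k₀ K T R₀ ω) {zz : Site 2}
    (hzz : zz ∈ (D.A 1).support) (hz0 : zz ∈ haFin m)
    (hstage : ∀ v' < D.uMin, ∀ c' z', (intDom m).lowestSeq ω v' = some (c', z') →
      ∀ t ∈ ((D.A 1).takeUntil zz hzz).support, t ∉ c') :
    ∃ P : Set (Site 2), D.GoodSet P ∧ (∃ f ∈ P, f ∈ (intDom m).F) ∧ zz ∈ P ∧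
      (∀ v ∈ P, v ∈ ((D.A 1).takeUntil zz hzz).support) ∧ (∀ v ∈ P, v ∈ (intDom m).J → v = zz) := by
  classical
  have hij : (1 : Fin 2) ≠ 0 := by decide
  obtain ⟨f, β, γ, -, hfI, -, hγD, hγsub⟩ := int_exists_entry_subwalk (D.A 1) (D.isPath 1) (fun v hv => D.norm_ge hv)
    (D.b_far 1) hzz (mem_haFin.1 hz0).1 (mem_haFin.1 hz0).2.2
  have hA : ∀ v ∈ γ.support, v ∈ (D.A 1).support := fun v hv => (D.A 1).support_takeUntil_subset_support hzz (hγsub v hv)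
  refine ⟨{v | v ∈ γ.support}, ?_, ⟨f, γ.start_mem_support, hfI⟩, γ.end_mem_support, hγsub, fun v hv hvO => ?_⟩
  · exact
      { sub_D := fun v hv => Finset.mem_coe.2 (hγD v hv)
        sub_ω := fun v hv => D.mem_omega (hA v hv)
        conn := siteConn_walk γ
        avoid := fun v hv hvα => D.disj' hij (hA v hv) (D.αF_subset v hvα)
        stage := fun v' hv' c' z' h v hv => hstage v' hv' c' z' h v (hγsub v hv) }
  · -- a site of `trapO` on the arm is its end, which lies in the prefix up to `zz` only if it is `zz`
    have hvA := hA v hv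
    have hvn : triNorm v = m := by
      obtain ⟨h0', h1', h2'⟩ := (mem_intDom_J.1 hvO).2
      rw [triNorm_eq_max]; omega
    have hvy : v = D.y 1 := D.clean 1 v hvA hvn
    by_contra hne
    have := notMem_takeUntil_of_mem_takeUntil (D.A 1) hzz (hγsub v hv) hne hvA
    subst hvy
    rw [takeUntil_end_eq_self (D.A 1) (D.isPath 1)] at this
    exact this hzz

/-- **The component of an unreached site of `c` off `zz`, as a good set**, not reached, adjacent
to `zz ∈ c`. [folklore] -/
theorem exists_comp_goodSet (D : IntPairDataA m N k₀ K T R₀ ω) {zz : Site 2}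
    {c : Finset (Site 2)} {z : Site 2} (hu : (intDom m).lowestSeq ω D.uMin = some (c, z))
    (hzc : zz ∈ c) {a₀ : Site 2} (ha₀ : a₀ ∈ c) (ha₀z : a₀ ≠ zz) (ha₀R : a₀ ∉ D.Reach zz)
    (hαR : ∀ v ∈ D.αF, v ∈ D.Reach zz) :
    ∃ L : Set (Site 2), D.GoodSet L ∧ a₀ ∈ L ∧ L ⊆ (↑c : Set (Site 2)) \ {zz} ∧ (∀ v ∈ L, v ∉ D.Reach zz) ∧
      ∃ a ∈ L, triGraph.Adj zz a := by
  have hc := term_isCrossing hu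
  set L := siteComp ((↑c : Set (Site 2)) \ {zz}) a₀ with hL
  have ha₀L : a₀ ∈ L := mem_siteComp_self ⟨Finset.mem_coe.2 ha₀, ha₀z⟩
  have hLsub : L ⊆ (↑c : Set (Site 2)) \ {zz} := siteComp_subset _ _
  have hLR : ∀ v ∈ L, v ∉ D.Reach zz := fun v hv hvR =>
    ha₀R (D.reach_of_pathIn hvR ((siteConn_siteComp _ _ v hv a₀ ha₀L).mono fun w hw =>
      ⟨D.term_subset_Aset hu (hLsub hw).1, (hLsub hw).2⟩))
  refine ⟨L, ?_, ha₀L, hLsub, hLR, ?_⟩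
  · exact
      { sub_D := fun v hv => Finset.mem_coe.2 (hc.subset (hLsub hv).1)
        sub_ω := fun v hv => term_open hu (hLsub hv).1
        conn := siteConn_siteComp _ _
        avoid := fun v hv hvα => hLR v hv (hαR v hvα)
        stage := fun v' hv' c' z' h v hv hvc' => Finset.disjoint_left.1 (D.term_disjoint_of_lt hv' h hu) hvc' (hLsub hv).1 }
  · obtain ⟨a, b, -, hb, -, hab, hpa⟩ := (hc.conn a₀ ha₀ zz hzc).exit (R := {v : Site 2 | v ≠ zz}) ha₀z (fun h => h rfl)
    have hb' : b = zz := by simpa using hb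
    subst hb'
    exact ⟨a, hpa.mono fun w hw => ⟨hw.2, hw.1⟩, hab.symm⟩

/-! ### The theorem -/

/-- **A site of an arm is not a cut.** [cite: Nolin2008, §4.4 Lemma 15 (proof) (arXiv 0711.4948: Lemma 14, last paragraph)] -/
theorem not_isCut_of_mem_arm1 (D : IntPairDataA m N k₀ K T R₀ ω) {zz : Site 2} (hzz : zz ∈ (D.A 1).support) :
    ¬ D.IsCut zz := by
  classical
  intro hcutz
  -- the arm `0`, its minimal term, the fence
  have hij : (1 : Fin 2) ≠ 0 := by decide
  obtain ⟨c, z, hu, hmeet⟩ := D.uMin_spec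
  have hc := term_isCrossing hu
  have hzO := hc.tip_mem_J
  set Tf := D.fence hu with hTf
  have hzF : zz ∉ Tf.F := fun hF => D.fence_disjoint_arm hu hF ⟨1, hzz⟩
  have hqR : Tf.q ∉ D.Reach zz := D.q_not_reach hcutz hu hzF
  have hzAj : zz ∉ (D.A 0).support := D.disj' hij hzz
  have hAjR : ∀ x ∈ (D.A 0).support, x ∈ D.Reach zz := D.arm_subset_reach 0 hzAj
  obtain ⟨x, hx⟩ := hmeet
  rw [Finset.mem_inter] at hx
  have hxR : x ∈ D.Reach zz := hAjR x (D.αF_subset x hx.1)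
  have hαR : ∀ v ∈ D.αF, v ∈ D.Reach zz := fun v hv => hAjR v (D.αF_subset v hv)
  -- a tip-arc site of `c` is `z`; a tip-arc site of the arm `i` is `y i`
  have hcO : ∀ v ∈ c, v ∈ (intDom m).J → v = z := fun v hv hvO => hc.eq_tip v hv hvO
  ------------------------------------------------------------------
  -- CASE 1: `zz ∈ c` and an unreached site `a₀ ∈ c` adjacent-or-equal situation: the common sub-argument
  have case_c : zz ∈ c → ∀ a₀ ∈ c, a₀ ∉ D.Reach zz →
      (∀ S : Set (Site 2), D.GoodSet S → (∃ f ∈ S, f ∈ (intDom m).F) → zz ∈ S → a₀ ∈ S →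
        (∀ v ∈ S, v ∈ (intDom m).J → v = z) → False) → False := by
    intro hzc a₀ ha₀ ha₀R hfinish
    have hz0 : zz ∈ haFin m := hc.subset hzc
    have hstage := D.prefix_disjoint_earlier hcutz hzz hu hzc (SimpleGraph.Walk.end_mem_support _) (fun v hv _ => by
      simpa using hv)
    obtain ⟨P, hP, hPf, hzP, hPsub, hPO⟩ := D.exists_entry_goodSet hzz hz0 hstage
    have hPO' : ∀ v ∈ P, v ∈ (intDom m).J → v = z := fun v hv hvO => by
      have h1 := hPO v hv hvO; subst h1; exact hcO v hzc hvO
    by_cases ha₀z : a₀ = zz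
    · subst ha₀z; exact hfinish P hP hPf hzP hzP hPO'
    · obtain ⟨L, hL, ha₀L, hLsub, -, a, haL, hadj⟩ := D.exists_comp_goodSet hu hzc ha₀ ha₀z ha₀R hαR
      refine hfinish (P ∪ L) (hP.union_of_link hL hzP haL (Or.inr hadj)) ?_ (Or.inl hzP) (Or.inr ha₀L) ?_
      · obtain ⟨f, hf, hfI⟩ := hPf; exact ⟨f, Or.inl hf, hfI⟩
      · rintro v (hv | hv) hvO
        · exact hPO' v hv hvO
        · exact hcO v (hLsub hv).1 hvO
  -- with `a₀ = q ∈ c`: finish by `false_of_tip_mem` / `false_of_fence`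
  have finish_q : ∀ S : Set (Site 2), D.GoodSet S → (∃ f ∈ S, f ∈ (intDom m).F) → zz ∈ S → Tf.q ∈ S →
      (∀ v ∈ S, v ∈ (intDom m).J → v = z) → zz ∈ c → False := by
    intro S hS hSf hzS hqS hSO hzc
    by_cases hzS' : z ∈ S
    · exact hS.false_of_tip_mem hu hSf hzS' hSO
    · exact hS.false_of_fence hu hSf (fun v hv hvO => hzS' ((hSO v hv hvO) ▸ hv)) hzS hzc hqS
  ------------------------------------------------------------------
  rcases Tf.q_mem with hqc | ⟨i', hqA⟩
  · -- attached to the term: `zz ∈ c` (else `c`, reached through `x`, would contain the unreached `q`)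
    have hqc' : Tf.q ∈ c := Finset.mem_coe.1 hqc
    have hzc : zz ∈ c := by
      by_contra hzc; exact hqR (D.term_subset_reach hu hzc hx.2 hxR _ hqc')
    exact case_c hzc Tf.q hqc' hqR fun S hS hSf hzS hqS hSO => finish_q S hS hSf hzS hqS hSO hzc
  -- attached to an arm: not the arm `0` (reached)
  by_cases hi' : i' = 0
  · rw [hi'] at hqA; exact hqR (hAjR _ hqA)
  rw [fin2_eq_of_ne hij hi'] at hqA
  by_cases hqc : Tf.q ∈ c
  · have hzc : zz ∈ c := by
      by_contra hzc; exact hqR (D.term_subset_reach hu hzc hx.2 hxR _ hqc)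
    exact case_c hzc Tf.q hqc hqR fun S hS hSf hzS hqS hSO => finish_q S hS hSf hzS hqS hSO hzc
  ------------------------------------------------------------------
  -- CASE 2: attached to the arm `i` off `c`, at or after `zz`
  have hzq : zz ∈ ((D.A 1).takeUntil Tf.q hqA).support := by
    by_contra hno; exact hqR (D.mem_reach_of_prefix 1 hqA hno)
  obtain ⟨hqlow, hqbox⟩ := D.attach_geom hu hqA hqc
  have hk := D.one_le_kOf hu
  have hkM := D.kOf_lt hu
  obtain ⟨ℓ, s, β, hℓs, γ', hdec, hℓc, -, hγ'p, -, hℓmem⟩ := int_exists_last_contact (D.raw hu) hk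
    (by omega) hc (D.A 1) (D.isPath 1) (fun v hv => D.norm_ge hv) (fun v hv => D.mem_omega hv)
    (D.b_far_box 1 hu) hqA hqbox hqlow
  have hpath : ((D.A 1).takeUntil Tf.q hqA).IsPath := (D.isPath 1).takeUntil _
  have hℓq : ℓ ∈ ((D.A 1).takeUntil Tf.q hqA).support := hℓmem
  have hℓA : ℓ ∈ (D.A 1).support := (D.A 1).support_takeUntil_subset_support hqA hℓq
  have hβeq : β = ((D.A 1).takeUntil Tf.q hqA).takeUntil ℓ hℓq := prefix_eq_takeUntil hpath hdec hℓq
  have htakeℓ : ((D.A 1).takeUntil Tf.q hqA).takeUntil ℓ hℓq = (D.A 1).takeUntil ℓ hℓA := SimpleGraph.Walk.takeUntil_takeUntil _ _ _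
  have hβsupp : ∀ v, v ∈ β.support ↔ v ∈ ((D.A 1).takeUntil ℓ hℓA).support := fun v => by rw [hβeq, htakeℓ]
  have hright : ∀ v, v ∈ (SimpleGraph.Walk.cons hℓs γ').support ↔ v ∈ ((D.A 1).takeUntil Tf.q hqA).support ∧ (v ∉ β.support ∨ v = ℓ) :=
    fun v => mem_support_right_iff hpath hdec
  have hℓγ' : ℓ ∉ γ'.support := ((SimpleGraph.Walk.cons_isPath_iff hℓs γ').1 ((isPath_append_iff'.1 (hdec ▸ hpath)).2.1)).2
  -- the piece `seg = ℓ … q` as a good set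
  set seg : Set (Site 2) := {v | v ∈ (SimpleGraph.Walk.cons hℓs γ').support} with hseg
  have hsegq : ∀ v ∈ seg, v ∈ ((D.A 1).takeUntil Tf.q hqA).support := fun v hv => ((hright v).1 hv).1
  have hsegA : ∀ v ∈ seg, v ∈ (D.A 1).support := fun v hv => (D.A 1).support_takeUntil_subset_support hqA (hsegq v hv)
  have hseg_cases : ∀ v ∈ seg, v = ℓ ∨ v ∈ γ'.support := fun v hv => by
    rw [hseg, Set.mem_setOf_eq, SimpleGraph.Walk.support_cons, List.mem_cons] at hv; exact hv
  have hsegGood : D.GoodSet seg :=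
    { sub_D := fun v hv => by
        rcases hseg_cases v hv with h | h
        · subst h; exact Finset.mem_coe.2 (hc.subset hℓc)
        · exact Finset.mem_coe.2 (hγ'p v h).2.1
      sub_ω := fun v hv => D.mem_omega (hsegA v hv)
      conn := siteConn_walk _
      avoid := fun v hv hvα => D.disj' hij (hsegA v hv) (D.αF_subset v hvα)
      stage := fun v' hv' c' z' h v hv hvc' => by
        rcases hseg_cases v hv with h' | h'
        · subst h'; exact Finset.disjoint_left.1 (D.term_disjoint_of_lt hv' h hu) hvc' hℓc
        · exact (hγ'p v h').1 (JDomain.mem_lower.2 (Or.inr (D.term_below_of_lt hv' h hu hvc'))) }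
  have hqseg : Tf.q ∈ seg := SimpleGraph.Walk.end_mem_support _
  have hℓseg : ℓ ∈ seg := SimpleGraph.Walk.start_mem_support _
  -- a tip-arc site of the arm `i` up to `q` is the end `y i`, and then `q = y i`
  have hOq : ∀ v ∈ ((D.A 1).takeUntil Tf.q hqA).support, v ∈ (intDom m).J → v = D.y 1 ∧ Tf.q = D.y 1 := by
    intro v hv hvO
    have hvA := (D.A 1).support_takeUntil_subset_support hqA hv
    have hvn : triNorm v = m := by
      obtain ⟨h0', h1', h2'⟩ := (mem_intDom_J.1 hvO).2
      rw [triNorm_eq_max]; omega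
    have hvy : v = D.y 1 := D.clean 1 v hvA hvn
    refine ⟨hvy, ?_⟩
    by_contra hne
    have := notMem_takeUntil_of_mem_takeUntil (D.A 1) hqA hv (fun e => hne (by rw [← e, hvy])) hvA
    subst hvy
    rw [takeUntil_end_eq_self (D.A 1) (D.isPath 1)] at this
    exact this hqA
  have hsegO : ∀ v ∈ seg, v ∈ (intDom m).J → (v = ℓ ∧ ℓ = z) ∨ (v = Tf.q ∧ Tf.q = D.y 1) := by
    intro v hv hvO
    obtain ⟨hvy, hqy⟩ := hOq v (hsegq v hv) hvO
    rcases hseg_cases v hv with h | h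
    · exact Or.inl ⟨h, hcO ℓ hℓc (h ▸ hvO)⟩
    · exact Or.inr ⟨by rw [hvy, hqy], hqy⟩
  -- if `q = y i` lies above the tip of `α_j`: Lemma A with `seg` alone
  have hq_high : Tf.q = D.y 1 → (D.y 0) 1 < (D.y 1) 1 → False := fun hqy hlt =>
    hsegGood.not_mem_term hu hqseg (Finset.mem_union_right _ (JDomain.mem_Jabove.2 ⟨by rw [hqy]; exact mem_J_of_isIntJ (D.y1_isIntJ_of_q_eq hu hqbox hqy), by simpa [hqy] using hlt⟩))
      ℓ hℓseg hℓc
  have hyne : Tf.q = D.y 1 → (D.y 1) 1 ≠ (D.y 0) 1 := fun hqy h =>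
    D.y_ne hij (Site.eq_iff_two.2 ⟨(D.y1_isIntJ_of_q_eq hu hqbox hqy).1.trans D.y_isIntJ.1.symm, h⟩)
  -- the dispatcher: a good set `S` (from the start set, tip-arc sites `= z`, `z ∉ S`) sharing a site with `seg`,
  -- with a `c`-site in `S ∪ seg`, is impossible when `ℓ ≠ z`
  have dispatch : ℓ ≠ z → ∀ S : Set (Site 2), D.GoodSet S → (∃ f ∈ S, f ∈ (intDom m).F) →
      (∀ v ∈ S, v ∈ (intDom m).J → v = z ∨ (v = Tf.q ∧ Tf.q = D.y 1)) → z ∉ S → (∃ a ∈ S, a ∈ seg) →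
      (∃ w₀ ∈ S ∪ seg, w₀ ∈ c) → False := by
    intro hℓz S hS hSf hSO hzS ⟨a, haS, haseg⟩ ⟨w₀, hw₀, hw₀c⟩
    have hS' : D.GoodSet (S ∪ seg) := hS.union_of_link hsegGood haS haseg (Or.inl rfl)
    have hSf' : ∃ f ∈ S ∪ seg, f ∈ (intDom m).F := by obtain ⟨f, hf, hfI⟩ := hSf; exact ⟨f, Or.inl hf, hfI⟩
    have hO' : ∀ v ∈ S ∪ seg, v ∈ (intDom m).J → v = Tf.q ∧ Tf.q = D.y 1 := by
      rintro v (hv | hv) hvO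
      · rcases hSO v hv hvO with h | h
        · exact absurd (h ▸ hv) hzS
        · exact h
      · rcases hsegO v hv hvO with ⟨-, h2⟩ | h2
        · exact absurd h2 hℓz
        · exact h2
    by_cases hqy : Tf.q = D.y 1
    · rcases lt_or_gt_of_ne (hyne hqy) with hlt | hlt
      · exact hS'.false_of_tip hu hSf' (Or.inr hqseg) (by rw [hqy]; exact mem_J_of_isIntJ (D.y1_isIntJ_of_q_eq hu hqbox hqy)) (fun v hv hvO => (hO' v hv hvO).1) (hqy ▸ hlt)
      · exact hq_high hqy hlt
    · exact hS'.false_of_fence hu hSf' (fun v hv hvO => hqy (hO' v hv hvO).2) hw₀ hw₀c (Or.inr hqseg)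
  -- `ℓ` is joined to `q` along `seg`; if `zz ∉ seg` this runs off `zz`
  have hℓq_path : zz ∉ seg → PathIn triGraph (D.Aset \ {zz}) ℓ Tf.q := fun hzseg =>
    (PathIn.of_walk_mem_support (SimpleGraph.Walk.cons hℓs γ') (A := D.Aset \ {zz})
      (fun v hv => ⟨D.armSet_subset_Aset (D.mem_armSet (hsegA v hv)), fun e => hzseg (e ▸ hv)⟩) (SimpleGraph.Walk.end_mem_support _)).1
  ------------------------------------------------------------------
  -- position of `zz` in `takeUntil q = β ++ (ℓ :: γ')`
  by_cases hzℓ : zz = ℓ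
  · -- `zz = ℓ ∈ c`
    subst hzℓ
    refine case_c hℓc zz hℓc (fun h => (D.reach_subset h).2 rfl) fun S hS hSf hzS _ hSO => ?_
    by_cases hzS' : z ∈ S
    · exact hS.false_of_tip_mem hu hSf hzS' hSO
    · have hℓz : zz ≠ z := fun e => hzS' (e ▸ hzS)
      exact dispatch hℓz S hS hSf (fun v hv hvO => Or.inl (hSO v hv hvO)) hzS' ⟨zz, hzS, hℓseg⟩ ⟨zz, Or.inl hzS, hℓc⟩
  rcases (SimpleGraph.Walk.mem_support_append_iff _ _).1 (hdec ▸ hzq) with hzβ | hzγ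
  · ----------------------------------------------------------------
    -- `zz` strictly before `ℓ`: `zz ∉ seg`, so `ℓ` unreached (else `q` reached); hence `zz ∈ c`
    have hzseg : zz ∉ seg := fun hz2 => by
      rcases ((hright zz).1 hz2).2 with h' | h'
      · exact h' hzβ
      · exact hzℓ h'
    have hℓR : ℓ ∉ D.Reach zz := fun h => hqR (D.reach_of_pathIn h (hℓq_path hzseg))
    have hzc : zz ∈ c := by
      by_contra hzc; exact hℓR (D.term_subset_reach hu hzc hx.2 hxR ℓ hℓc)
    refine case_c hzc ℓ hℓc hℓR fun S hS hSf hzS hℓS hSO => ?_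
    by_cases hzS' : z ∈ S
    · exact hS.false_of_tip_mem hu hSf hzS' hSO
    · have hℓz : ℓ ≠ z := fun e => hzS' (e ▸ hℓS)
      exact dispatch hℓz S hS hSf (fun v hv hvO => Or.inl (hSO v hv hvO)) hzS' ⟨ℓ, hℓS, hℓseg⟩ ⟨ℓ, Or.inl hℓS, hℓc⟩
  · ----------------------------------------------------------------
    -- `zz` after `ℓ`, on the piece off `lower c`
    have hzγ' : zz ∈ γ'.support := by
      rw [SimpleGraph.Walk.support_cons, List.mem_cons] at hzγ
      rcases hzγ with h | h
      · exact absurd h hzℓ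
      · exact h
    have hzseg : zz ∈ seg := List.mem_cons_of_mem _ hzγ'
    obtain ⟨hzlow, hzD, -, -⟩ := hγ'p zz hzγ'
    -- `ℓ` is at or before `zz`
    have hℓz : ℓ ∈ ((D.A 1).takeUntil zz hzz).support := by
      rcases mem_takeUntil_or (D.A 1) hzz hℓA with h | h
      · exact h
      · exfalso
        have hzβ : zz ∈ β.support := (hβsupp zz).2 h
        rcases ((hright zz).1 hzseg).2 with h' | h'
        · exact h' hzβ
        · exact hzℓ h'
    -- every `lower c`-site of the arm up to `zz` is at or before `ℓ`
    have hbetween : ∀ v ∈ ((D.A 1).takeUntil zz hzz).support, v ∈ (intDom m).lower c z →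
        v ∈ ((D.A 1).takeUntil ℓ ((D.A 1).support_takeUntil_subset_support hzz hℓz)).support := by
      intro v hv hvl
      have hvq : v ∈ ((D.A 1).takeUntil Tf.q hqA).support := support_takeUntil_subset_of_mem (D.A 1) hqA hzq hv
      rcases (SimpleGraph.Walk.mem_support_append_iff _ _).1 (hdec ▸ hvq) with hvβ | hvγ
      · exact (hβsupp v).1 hvβ
      · rw [SimpleGraph.Walk.support_cons, List.mem_cons] at hvγ
        rcases hvγ with h | h
        · subst h; exact SimpleGraph.Walk.end_mem_support _
        · exact absurd hvl (hγ'p v h).1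
    have hstage := D.prefix_disjoint_earlier hcutz hzz hu hℓc hℓz hbetween
    by_cases hℓz' : ℓ = z
    · -- the arm passes through the tip of `c` before `zz`: the entry piece at `ℓ` is a crossing with tip `z`
      have hℓ0 : ℓ ∈ haFin m := hc.subset hℓc
      have hstageℓ : ∀ v' < D.uMin, ∀ c' z', (intDom m).lowestSeq ω v' = some (c', z') →
          ∀ t ∈ ((D.A 1).takeUntil ℓ hℓA).support, t ∉ c' := fun v' hv' c' z' h t ht =>
        hstage v' hv' c' z' h t (support_takeUntil_subset_of_mem (D.A 1) hzz hℓz ht)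
      obtain ⟨P, hP, hPf, hℓP, -, hPO⟩ := D.exists_entry_goodSet hℓA hℓ0 hstageℓ
      exact hP.false_of_tip_mem hu hPf (hℓz' ▸ hℓP) (fun v hv hvO => (hPO v hv hvO).trans hℓz')
    · obtain ⟨P, hP, hPf, hzP, hPsub, hPO⟩ := D.exists_entry_goodSet hzz hzD hstage
      have hzc : zz ∉ c := fun h => hzlow (JDomain.mem_lower.2 (Or.inl h))
      have hPO' : ∀ v ∈ P, v ∈ (intDom m).J → v = z ∨ (v = Tf.q ∧ Tf.q = D.y 1) := fun v hv hvO => by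
        -- a tip-arc site of `P` is `zz ∈ seg`: use `hsegO`
        have h1 := hPO v hv hvO
        subst h1
        rcases hsegO v hzseg hvO with ⟨h2, -⟩ | h2
        · exact absurd h2 hzℓ
        · exact Or.inr h2
      have hzP' : z ∉ P := fun h => hzc (by rw [← hPO z h hzO]; exact hc.tip_mem)
      exact dispatch hℓz' P hP hPf hPO' hzP' ⟨zz, hzP, hzseg⟩ ⟨ℓ, Or.inr hℓseg, hℓc⟩

end IntPairDataA

end Literature.Probability.Percolation
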